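import Mathlib
import Literature.MathematicalPhysics.StatisticalMechanics.BoltzmannB4HardSpheres
import HarnessLib

/-!
# Boltzmann's `B₄` for hard spheres in `D = 3` — proofs, part 1: the ring and diamond diagrams

Topic `Literature/MathematicalPhysics/StatisticalMechanics`; `Proofs` companion of
`BoltzmannB4HardSpheres.lean` (named fact
`Literature.MathematicalPhysics.StatisticalMechanics.Boltzmann1899_B4_hardSpheres_dim3`,
[Lyberg2005, §1]). The discharge `Boltzmann1899_B4_hardSpheres_dim3_holds` is assembled in this
file bottom-up across several landings; this first part proves, sorry-free, the EXACT Lebesgue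
volumes of two of the three Mayer-diagram configuration sets of the fact:

* `volume_hardSphereRingFour_toReal   : (volume hardSphereRingFour).toReal   = 2176 π³ / 2835`
  (so `[ring]/B₂³ = 272/105`),
* `volume_hardSphereDiamondFour_toReal : (volume hardSphereDiamondFour).toReal = 6347 π³ / 11340`
  (so `vol(◇)/B₂³ = 6347/3360`),

with `B₂ = 2π/3`. These are the two "lower order diagrams" of `B₄` that Lyberg (2005, §2, after
display (13)) takes from Luban–Baram's closed forms; here they are computed from scratch.

## Proof architecture (Lyberg 2005 §2 / Nijboer–van Hove 1952: reduce by one centre, then a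
radial integral)

1. `BoltzmannB4.cfg` : the volume-preserving coordinate change `(Fin 9 → ℝ) ≃ᵐ E × (E × E)`,
   `E = EuclideanSpace ℝ (Fin 3)`, `x ↦ (r₂, (r₃, r₄))`; the fact's sets become
   `{‖r₂‖ < 1, dist r₂ r₃ < 1, dist r₃ r₄ < 1, ‖r₄‖ < 1}` (ring) and the same with `‖r₃‖ < 1`
   (diamond) (`ring_eq_preimage`, `diamond_eq_preimage`).
2. **Lens volume** (`BoltzmannB4.volume_lens`): for `b : E`,
   `vol(B(0,1) ∩ B(b,1)) = lensFun ‖b‖`, `lensFun t = π(16 − 12t + t³)/12 = (π/12)(4+t)(2−t)²`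
   for `t ≤ 2` and `0` beyond: a Householder reflection (`Submodule.reflection_sub`) moves `b`
   to the first axis, the axis lens is sliced perpendicular to the axis
   (`MeasurableEquiv.piFinSuccAbove`, disc area `volume_disc`), and the slice areas
   `π·min(1 − z², 1 − (z − t)²)` are integrated (`lintegral_lens`).
3. **Tonelli** over the middle centre `r₃ = b` (`volume_ringE_eq_lintegral`,
   `volume_diamondE_eq_lintegral`): `vol(ring) = ∫ lensFun(‖b‖)² db`,
   `vol(◇) = ∫_{‖b‖<1} lensFun(‖b‖)² db`.
4. **Radial integral** (`integral_fun_norm_addHaar`, `integral_norm_E`):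
   `∫ h(‖b‖) db = 4π ∫₀^∞ y² h(y) dy`, and `∫₀^c y²(16−12y+y³)² dy = Qpoly c` with
   `Qpoly 2 = 8704/315`, `Qpoly 1 = 6347/315` (`integral_poly`).

NOT here (later parts): the complete star `hardSphereStarFour` — its reduction
`vol(K₄) = (8π/3)·T(1)` to the two-centre lens-pair volume `T(1)` at contact (Lyberg display (13),
`[cs] = −4B₂ χ(1)`), the cylindrical reduction of `T(1)`, and its closed form
`T(1) = −(89/630)π² − (73/840)π√2 + (4131/5040)π·arccos(1/3)`.

## References

* [Lyberg2005] I. Lyberg, J. Stat. Phys. 119 (2005) 747–764, §§1–2.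
* [NijboerVanhove1952] B. R. A. Nijboer, L. Van Hove, Phys. Rev. 85 (1952) 777–783.
-/

noncomputable section

open _root_.MeasureTheory _root_.Set _root_.Metric _root_.Real intervalIntegral
open scoped Pointwise ENNReal

namespace Literature.MathematicalPhysics.StatisticalMechanics

namespace BoltzmannB4

local notation "E" => EuclideanSpace ℝ (Fin 3)
local notation "E2" => EuclideanSpace ℝ (Fin 2)

/-! ### Coordinates: `ℝ⁹ ≃ E × (E × E)` -/

/-- Split `Fin (m+n) → ℝ` into the first `m` and the last `n` coordinates (measurable
equivalence). [folklore] -/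
def split (m n : ℕ) : (Fin (m + n) → ℝ) ≃ᵐ (Fin m → ℝ) × (Fin n → ℝ) :=
  ((MeasurableEquiv.piCongrLeft (fun _ : Fin (m + n) => ℝ) finSumFinEquiv).symm).trans
    (MeasurableEquiv.sumPiEquivProdPi fun _ : Fin m ⊕ Fin n => ℝ)

/-- First block of `split`. [folklore] -/
@[simp] theorem split_apply_fst {m n : ℕ} (x : Fin (m + n) → ℝ) (i : Fin m) :
    (split m n x).1 i = x (Fin.castAdd n i) := by
  simp [split, MeasurableEquiv.piCongrLeft, Equiv.piCongrLeft_symm_apply,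
    MeasurableEquiv.sumPiEquivProdPi]

/-- Second block of `split`. [folklore] -/
@[simp] theorem split_apply_snd {m n : ℕ} (x : Fin (m + n) → ℝ) (i : Fin n) :
    (split m n x).2 i = x (Fin.natAdd m i) := by
  simp [split, MeasurableEquiv.piCongrLeft, Equiv.piCongrLeft_symm_apply,
    MeasurableEquiv.sumPiEquivProdPi]

/-- `split` preserves Lebesgue measure. [folklore] -/
theorem volume_preserving_split (m n : ℕ) :
    MeasurePreserving (split m n) volume volume :=
  ((volume_measurePreserving_piCongrLeft (fun _ : Fin (m + n) => ℝ) finSumFinEquiv).symm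
    _).trans (volume_measurePreserving_sumPiEquivProdPi fun _ : Fin m ⊕ Fin n => ℝ)

/-- `Fin 3 → ℝ` as Euclidean `3`-space (measurable equivalence `toLp`). [folklore] -/
def toE : (Fin 3 → ℝ) ≃ᵐ E := MeasurableEquiv.toLp 2 (Fin 3 → ℝ)

/-- `toE` preserves Lebesgue measure. [folklore] -/
theorem volume_preserving_toE : MeasurePreserving toE volume volume :=
  PiLp.volume_preserving_toLp (Fin 3)

/-- The coordinate change `ℝ⁹ ≃ E × (E × E)`, `x ↦ (r₂, (r₃, r₄))` with
`r₂ = (x 0, x 1, x 2)`, `r₃ = (x 3, x 4, x 5)`, `r₄ = (x 6, x 7, x 8)`. [folklore] -/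
def cfg : (Fin 9 → ℝ) ≃ᵐ E × (E × E) :=
  (split 3 6).trans
    (MeasurableEquiv.prodCongr toE ((split 3 3).trans (MeasurableEquiv.prodCongr toE toE)))

/-- `cfg` preserves Lebesgue measure. [folklore] -/
theorem volume_preserving_cfg : MeasurePreserving cfg volume volume :=
  (volume_preserving_split 3 6).trans
    (volume_preserving_toE.prod ((volume_preserving_split 3 3).trans
      (volume_preserving_toE.prod volume_preserving_toE)))

/-- The nine coordinates of `cfg x`. [folklore] -/
theorem cfg_apply (x : Fin 9 → ℝ) :
    (cfg x).1.ofLp 0 = x 0 ∧ (cfg x).1.ofLp 1 = x 1 ∧ (cfg x).1.ofLp 2 = x 2 ∧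
    (cfg x).2.1.ofLp 0 = x 3 ∧ (cfg x).2.1.ofLp 1 = x 4 ∧ (cfg x).2.1.ofLp 2 = x 5 ∧
    (cfg x).2.2.ofLp 0 = x 6 ∧ (cfg x).2.2.ofLp 1 = x 7 ∧ (cfg x).2.2.ofLp 2 = x 8 := by
  simp [cfg, toE, MeasurableEquiv.prodCongr]
  refine ⟨rfl, rfl, rfl, rfl, rfl, rfl, rfl, rfl, rfl⟩

/-- `‖a‖ < 1` in coordinates. [folklore] -/
theorem mem_ball_zero_iff_coord (a : E) : a ∈ ball (0 : E) 1 ↔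
    a.ofLp 0 ^ 2 + a.ofLp 1 ^ 2 + a.ofLp 2 ^ 2 < 1 := by
  rw [mem_ball_zero_iff, EuclideanSpace.norm_eq]
  simp only [Real.norm_eq_abs, sq_abs, Fin.sum_univ_three]
  rw [Real.sqrt_lt' one_pos, one_pow]

/-- `‖a‖ < 1` in coordinates. [folklore] -/
theorem norm_lt_one_iff (a : E) : ‖a‖ < 1 ↔ a.ofLp 0 ^ 2 + a.ofLp 1 ^ 2 + a.ofLp 2 ^ 2 < 1 := by
  rw [← mem_ball_zero_iff]; exact mem_ball_zero_iff_coord a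

/-- `dist a b < 1` in coordinates. [folklore] -/
theorem dist_lt_one_iff (a b : E) : dist a b < 1 ↔
    (a.ofLp 0 - b.ofLp 0) ^ 2 + (a.ofLp 1 - b.ofLp 1) ^ 2 + (a.ofLp 2 - b.ofLp 2) ^ 2 < 1 := by
  rw [EuclideanSpace.dist_eq]
  simp only [Fin.sum_univ_three, Real.dist_eq, sq_abs]
  rw [Real.sqrt_lt' one_pos, one_pow]

/-! ### The lens `B(0,1) ∩ B(b,1)` and its volume -/

/-- Area of a disc, written in coordinates: `vol{w : ℝ² | w₀² + w₁² < r} = π r` (`= 0` for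
`r ≤ 0`, where both sides vanish). [folklore] -/
theorem volume_disc (r : ℝ) :
    volume {w : Fin 2 → ℝ | w 0 ^ 2 + w 1 ^ 2 < r} = ENNReal.ofReal (π * r) := by
  rcases le_or_gt r 0 with hr | hr
  · have : {w : Fin 2 → ℝ | w 0 ^ 2 + w 1 ^ 2 < r} = ∅ := by
      ext w
      simp only [mem_setOf_eq, mem_empty_iff_false, iff_false, not_lt]
      nlinarith [sq_nonneg (w 0), sq_nonneg (w 1)]
    rw [this, measure_empty, ENNReal.ofReal_of_nonpos (by nlinarith [pi_pos])]
  · set s := Real.sqrt r with hs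
    have hs0 : 0 ≤ s := Real.sqrt_nonneg r
    have hs2 : s ^ 2 = r := Real.sq_sqrt hr.le
    have hset : {w : Fin 2 → ℝ | w 0 ^ 2 + w 1 ^ 2 < r} =
        (WithLp.toLp 2) ⁻¹' (ball (0 : E2) s) := by
      ext w
      rw [EuclideanSpace.ball_zero_eq s hs0]
      simp [Fin.sum_univ_two, hs2]
    rw [hset, (PiLp.volume_preserving_toLp (Fin 2)).measure_preimage
      measurableSet_ball.nullMeasurableSet, EuclideanSpace.volume_ball_fin_two,
      ← ENNReal.ofReal_pow hs0, hs2, ← ENNReal.ofReal_mul hr.le, mul_comm]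

/-- The unit vector along the first axis of `E`. [folklore] -/
def e0 : E := EuclideanSpace.single (0 : Fin 3) (1 : ℝ)

/-- `‖e0‖ = 1`. [folklore] -/
theorem norm_e0 : ‖e0‖ = 1 := by
  simp [e0]

/-- Coordinates of `e0`. [folklore] -/
theorem e0_apply (i : Fin 3) : e0.ofLp i = if i = 0 then 1 else 0 := by
  simp [e0]

/-- The lens-volume polynomial `π(16 − 12t + t³)/12 = (π/12)(4 + t)(2 − t)²` (volume of the
intersection of two unit balls at centre distance `t ∈ [0, 2]`). [folklore] -/
def lensVol (t : ℝ) : ℝ := π * (16 - 12 * t + t ^ 3) / 12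

/-- The lens volume as a function of the centre distance on `[0, ∞)`: `lensVol` up to `2`, then
`0`. [folklore] -/
def lensFun (t : ℝ) : ℝ := if t ≤ 2 then lensVol t else 0

/-- `lensVol 2 = 0`. [folklore] -/
theorem lensVol_two : lensVol 2 = 0 := by simp [lensVol]; ring

/-- `lensVol ≥ 0` on `[0, 2]`. [folklore] -/
theorem lensVol_nonneg {t : ℝ} (ht0 : 0 ≤ t) (_ht2 : t ≤ 2) : 0 ≤ lensVol t := by
  have : lensVol t = π / 12 * ((4 + t) * (2 - t) ^ 2) := by simp [lensVol]; ring
  rw [this]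
  exact mul_nonneg (div_nonneg pi_pos.le (by norm_num)) (mul_nonneg (by linarith) (sq_nonneg _))

/-- `lensFun ≥ 0` on `[0, ∞)`. [folklore] -/
theorem lensFun_nonneg (t : ℝ) (ht : 0 ≤ t) : 0 ≤ lensFun t := by
  simp only [lensFun]
  split_ifs with h
  · exact lensVol_nonneg ht h
  · exact le_rfl

/-- `lensFun t = 0` for `t > 2`. [folklore] -/
theorem lensFun_of_gt {t : ℝ} (h : 2 < t) : lensFun t = 0 := by
  simp [lensFun, not_le.mpr h]

/-- `lensFun t = lensVol t` for `t ≤ 2`. [folklore] -/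
theorem lensFun_of_le {t : ℝ} (h : t ≤ 2) : lensFun t = lensVol t := by
  simp [lensFun, h]

/-- `lensFun` is continuous. [folklore] -/
theorem continuous_lensFun : Continuous lensFun := by
  have : lensFun = fun t => if t ≤ 2 then lensVol t else 0 := rfl
  rw [this]
  refine Continuous.if_le (f' := lensVol) ?_ continuous_const continuous_id continuous_const ?_
  · unfold lensVol; fun_prop
  · intro x hx
    rw [hx, lensVol_two]

/-- Membership in the ball around `t • e0` in coordinates. [folklore] -/
theorem mem_ball_axis_iff_coord (a : E) (t : ℝ) : a ∈ ball (t • e0) 1 ↔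
    (a.ofLp 0 - t) ^ 2 + a.ofLp 1 ^ 2 + a.ofLp 2 ^ 2 < 1 := by
  rw [mem_ball, EuclideanSpace.dist_eq]
  simp only [Fin.sum_univ_three, Real.dist_eq, sq_abs]
  rw [Real.sqrt_lt' one_pos, one_pow]
  simp [e0_apply]

/-- Measurability helper. [folklore] -/
theorem measurable_quad3 (t : ℝ) :
    Measurable fun y : Fin 3 → ℝ => (y 0 - t) ^ 2 + y 1 ^ 2 + y 2 ^ 2 := by fun_prop

/-- **Slicing the axis lens**: `vol(B(0,1) ∩ B(t e0, 1)) = ∫ π·min(1 − z², 1 − (z−t)²)⁺ dz`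
(the slices perpendicular to the axis are discs). [folklore] -/
theorem volume_axisLens_eq_lintegral (t : ℝ) :
    volume (ball (0 : E) 1 ∩ ball (t • e0) 1) =
      ∫⁻ z : ℝ, ENNReal.ofReal (π * min (1 - z ^ 2) (1 - (z - t) ^ 2)) := by
  have h1 : ball (0 : E) 1 ∩ ball (t • e0) 1 = (MeasurableEquiv.toLp 2 (Fin 3 → ℝ)).symm ⁻¹'
      {y : Fin 3 → ℝ | (y 0 - 0) ^ 2 + y 1 ^ 2 + y 2 ^ 2 < 1 ∧
        (y 0 - t) ^ 2 + y 1 ^ 2 + y 2 ^ 2 < 1} := by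
    ext a
    simp only [mem_inter_iff, mem_preimage, mem_setOf_eq, mem_ball_zero_iff_coord,
      mem_ball_axis_iff_coord, sub_zero]
    rfl
  have hSm : MeasurableSet {y : Fin 3 → ℝ | (y 0 - 0) ^ 2 + y 1 ^ 2 + y 2 ^ 2 < 1 ∧
      (y 0 - t) ^ 2 + y 1 ^ 2 + y 2 ^ 2 < 1} :=
    (measurableSet_lt (measurable_quad3 0) measurable_const).inter
      (measurableSet_lt (measurable_quad3 t) measurable_const)
  rw [h1, (EuclideanSpace.volume_preserving_symm_measurableEquiv_toLp (Fin 3)).measure_preimage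
    hSm.nullMeasurableSet]
  set φ := MeasurableEquiv.piFinSuccAbove (fun _ : Fin 3 => ℝ) 0 with hφ
  have hφm : MeasurePreserving φ volume volume :=
    volume_preserving_piFinSuccAbove (fun _ : Fin 3 => ℝ) 0
  have hPm : MeasurableSet
      {p : ℝ × (Fin 2 → ℝ) | p.2 0 ^ 2 + p.2 1 ^ 2 < min (1 - p.1 ^ 2) (1 - (p.1 - t) ^ 2)} :=
    measurableSet_lt (by fun_prop) (by fun_prop)
  have h2 : {y : Fin 3 → ℝ | (y 0 - 0) ^ 2 + y 1 ^ 2 + y 2 ^ 2 < 1 ∧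
      (y 0 - t) ^ 2 + y 1 ^ 2 + y 2 ^ 2 < 1}
      = φ ⁻¹' {p : ℝ × (Fin 2 → ℝ) | p.2 0 ^ 2 + p.2 1 ^ 2 <
          min (1 - p.1 ^ 2) (1 - (p.1 - t) ^ 2)} := by
    ext y
    simp only [mem_setOf_eq, mem_preimage, hφ, MeasurableEquiv.piFinSuccAbove_apply, lt_min_iff,
      Fin.insertNthEquiv_zero, Fin.consEquiv, Equiv.coe_fn_symm_mk, Fin.tail, Fin.succ_zero_eq_one,
      Fin.succ_one_eq_two]
    constructor <;> rintro ⟨ha, hb⟩ <;> constructor <;> linarith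
  rw [h2, hφm.measure_preimage hPm.nullMeasurableSet, Measure.volume_eq_prod, Measure.prod_apply hPm]
  congr 1
  ext z
  have : Prod.mk z ⁻¹' {p : ℝ × (Fin 2 → ℝ) | p.2 0 ^ 2 + p.2 1 ^ 2 <
      min (1 - p.1 ^ 2) (1 - (p.1 - t) ^ 2)}
      = {w : Fin 2 → ℝ | w 0 ^ 2 + w 1 ^ 2 < min (1 - z ^ 2) (1 - (z - t) ^ 2)} := by
    ext w; simp
  rw [this, volume_disc]

/-- `∫_a^b π(1 − (z − c)²) dz`. [folklore] -/
theorem integral_one_sub_sq_shift (a b c : ℝ) :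
    ∫ z in a..b, π * (1 - (z - c) ^ 2) =
      π * ((b - (b - c) ^ 3 / 3) - (a - (a - c) ^ 3 / 3)) := by
  have hderiv : ∀ z ∈ uIcc a b,
      HasDerivAt (fun z => π * (z - (z - c) ^ 3 / 3)) (π * (1 - (z - c) ^ 2)) z := by
    intro z _
    have h1 : HasDerivAt (fun z : ℝ => (z - c) ^ 3 / 3) (3 * (z - c) ^ 2 * 1 / 3) z :=
      (((hasDerivAt_id z).sub_const c).pow 3).div_const 3
    have h2 := ((hasDerivAt_id z).sub h1).const_mul π
    exact h2.congr_deriv (by ring)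
  rw [integral_eq_sub_of_hasDerivAt hderiv ((by fun_prop : Continuous fun z : ℝ =>
    π * (1 - (z - c) ^ 2)).intervalIntegrable _ _)]
  ring

/-- **The axis-lens integral**: `∫ π·min(1 − z², 1 − (z−t)²)⁺ dz = lensVol t` for `0 ≤ t ≤ 2`
(the integrand is supported on `(t − 1, 1]` and the `min` switches at `z = t/2`). [folklore] -/
theorem lintegral_lens {t : ℝ} (ht0 : 0 ≤ t) (ht2 : t ≤ 2) :
    ∫⁻ z : ℝ, ENNReal.ofReal (π * min (1 - z ^ 2) (1 - (z - t) ^ 2)) =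
      ENNReal.ofReal (lensVol t) := by
  set f : ℝ → ℝ := fun z => π * min (1 - z ^ 2) (1 - (z - t) ^ 2) with hf
  have hfc : Continuous f := by
    simp only [hf]; fun_prop
  have hind : (fun z => ENNReal.ofReal (f z)) =
      (Ioc (t - 1) 1).indicator fun z => ENNReal.ofReal (f z) := by
    ext z
    by_cases hz : z ∈ Ioc (t - 1) 1
    · simp [hz]
    · rw [indicator_of_notMem hz, ENNReal.ofReal_of_nonpos]
      simp only [mem_Ioc, not_and_or, not_lt, not_le] at hz
      have hπ : 0 < π := pi_pos
      rcases hz with hz | hz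
      · have : 1 - (z - t) ^ 2 ≤ 0 := by nlinarith
        have : min (1 - z ^ 2) (1 - (z - t) ^ 2) ≤ 0 := le_trans (min_le_right _ _) this
        simp only [hf]; nlinarith
      · have : 1 - z ^ 2 ≤ 0 := by nlinarith
        have : min (1 - z ^ 2) (1 - (z - t) ^ 2) ≤ 0 := le_trans (min_le_left _ _) this
        simp only [hf]; nlinarith
  have hnn : ∀ z ∈ Ioc (t - 1) 1, 0 ≤ f z := by
    intro z hz
    simp only [mem_Ioc] at hz
    have h1 : 0 ≤ 1 - z ^ 2 := by nlinarith
    have h2 : 0 ≤ 1 - (z - t) ^ 2 := by nlinarith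
    simp only [hf]
    exact mul_nonneg pi_pos.le (le_min h1 h2)
  change ∫⁻ z, ENNReal.ofReal (f z) = _
  rw [hind, lintegral_indicator measurableSet_Ioc,
    ← ofReal_integral_eq_lintegral_ofReal (hfc.integrableOn_Icc.mono_set Ioc_subset_Icc_self)
      (ae_restrict_of_forall_mem measurableSet_Ioc hnn),
    ← integral_of_le (by linarith), ← integral_add_adjacent_intervals (b := t / 2)
      (hfc.intervalIntegrable _ _) (hfc.intervalIntegrable _ _)]
  have hleft : ∫ z in (t - 1)..(t / 2), f z = ∫ z in (t - 1)..(t / 2), π * (1 - (z - t) ^ 2) := by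
    apply integral_congr
    intro z hz
    rw [uIcc_of_le (by linarith)] at hz
    simp only [hf]
    rw [min_eq_right]
    nlinarith [hz.2]
  have hright : ∫ z in (t / 2)..1, f z = ∫ z in (t / 2)..1, π * (1 - (z - 0) ^ 2) := by
    apply integral_congr
    intro z hz
    rw [uIcc_of_le (by linarith)] at hz
    simp only [hf, sub_zero]
    rw [min_eq_left]
    nlinarith [hz.1]
  rw [hleft, hright, integral_one_sub_sq_shift, integral_one_sub_sq_shift]
  congr 1
  simp only [lensVol]
  ring

/-- **Volume of the lens `B(0,1) ∩ B(b,1)`** in `ℝ³`: `lensFun ‖b‖`, i.e.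
`(π/12)(4 + ‖b‖)(2 − ‖b‖)²` for `‖b‖ ≤ 2` and `0` otherwise. A Householder reflection
(`Submodule.reflection_sub`) moves `b` onto the first axis. [folklore] -/
theorem volume_lens (b : E) :
    volume (ball (0 : E) 1 ∩ ball b 1) = ENNReal.ofReal (lensFun ‖b‖) := by
  by_cases hb : ‖b‖ ≤ 2
  · have hw : ‖b‖ = ‖(‖b‖ : ℝ) • e0‖ := by rw [norm_smul, norm_norm, norm_e0, mul_one]
    have hR := Submodule.reflection_sub hw
    set R := (ℝ ∙ (b - ‖b‖ • e0))ᗮ.reflection with hRdef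
    have hset : ball (0 : E) 1 ∩ ball b 1 = R ⁻¹' (ball (0 : E) 1 ∩ ball (‖b‖ • e0) 1) := by
      rw [preimage_inter, LinearIsometryEquiv.preimage_ball, LinearIsometryEquiv.preimage_ball,
        map_zero, ← hR, LinearIsometryEquiv.symm_apply_apply]
    rw [hset, R.measurePreserving.measure_preimage
      (measurableSet_ball.inter measurableSet_ball).nullMeasurableSet,
      volume_axisLens_eq_lintegral, lintegral_lens (norm_nonneg b) hb]
    simp [lensFun, hb]
  · push Not at hb
    have hdis : Disjoint (ball (0 : E) 1) (ball b 1) := by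
      apply ball_disjoint_ball
      rw [dist_eq_norm, zero_sub, norm_neg]
      linarith
    rw [hdis.inter_eq, measure_empty]
    simp [lensFun, not_le.mpr hb]

/-- The lens with poles `0` and `b`. [folklore] -/
def lensSet (b : E) : Set E := ball 0 1 ∩ ball b 1

/-- Membership in `lensSet`. [folklore] -/
theorem mem_lensSet {a b : E} : a ∈ lensSet b ↔ dist a 0 < 1 ∧ dist a b < 1 := by
  simp [lensSet, mem_ball]

/-- `lensSet b` is measurable. [folklore] -/
theorem measurableSet_lensSet (b : E) : MeasurableSet (lensSet b) :=
  measurableSet_ball.inter measurableSet_ball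

/-- `vol(lensSet b) = lensFun ‖b‖`. [folklore] -/
theorem volume_lensSet (b : E) : volume (lensSet b) = ENNReal.ofReal (lensFun ‖b‖) :=
  volume_lens b

/-! ### Tonelli over the middle centre -/

/-- Measurability of the pair set `{(b,c) | c ∈ lensSet b}`. [folklore] -/
theorem measurableSet_pairLens : MeasurableSet {y : E × E | y.2 ∈ lensSet y.1} := by
  have : {y : E × E | y.2 ∈ lensSet y.1} =
      {y : E × E | dist y.2 0 < 1} ∩ {y : E × E | dist y.2 y.1 < 1} := by
    ext y; simp [mem_lensSet]
  rw [this]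
  exact (measurableSet_lt (by fun_prop) measurable_const).inter
    (measurableSet_lt (by fun_prop) (by fun_prop))

/-- `b ↦ lensFun ‖b‖` (as `ℝ≥0∞`) is measurable. [folklore] -/
theorem measurable_ofReal_lensFun_norm : Measurable fun b : E => ENNReal.ofReal (lensFun ‖b‖) :=
  (ENNReal.continuous_ofReal.comp (continuous_lensFun.comp continuous_norm)).measurable

/-- **Tonelli step**: `∫∫ 𝟙[c ∈ L(b)] w(b) dc db = ∫ w(b)·vol(L(b)) db`. [folklore] -/
theorem lintegral_pair_indicator (w : E → ENNReal) (hw : Measurable w) :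
    ∫⁻ y : E × E, {y : E × E | y.2 ∈ lensSet y.1}.indicator (fun y => w y.1) y =
      ∫⁻ b : E, w b * ENNReal.ofReal (lensFun ‖b‖) := by
  have hf : Measurable fun y : E × E =>
      {y : E × E | y.2 ∈ lensSet y.1}.indicator (fun y => w y.1) y :=
    (hw.comp measurable_fst).indicator measurableSet_pairLens
  rw [Measure.volume_eq_prod, lintegral_prod _ hf.aemeasurable]
  congr 1
  ext b
  have : (fun c => {y : E × E | y.2 ∈ lensSet y.1}.indicator (fun y => w y.1) (b, c)) =
      (lensSet b).indicator fun _ => w b := by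
    ext c
    by_cases hc : c ∈ lensSet b <;> simp [hc]
  rw [this, lintegral_indicator_const (measurableSet_lensSet b), volume_lensSet]

/-- The ring configuration set in block form `(r₂, (r₃, r₄))`: `r₂, r₄ ∈ L(r₃)`. [folklore] -/
def ringE : Set (E × (E × E)) := {p | p.1 ∈ lensSet p.2.1 ∧ p.2.2 ∈ lensSet p.2.1}

/-- The diamond configuration set in block form: `‖r₃‖ < 1` and `r₂, r₄ ∈ L(r₃)`. [folklore] -/
def diamondE : Set (E × (E × E)) :=
  {p | dist p.2.1 0 < 1 ∧ p.1 ∈ lensSet p.2.1 ∧ p.2.2 ∈ lensSet p.2.1}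

/-- `ringE` is measurable. [folklore] -/
theorem measurableSet_ringE : MeasurableSet ringE := by
  have : ringE = ({p : E × (E × E) | dist p.1 0 < 1} ∩ {p | dist p.1 p.2.1 < 1}) ∩
      ({p | dist p.2.2 0 < 1} ∩ {p | dist p.2.2 p.2.1 < 1}) := by
    ext p; simp [ringE, mem_lensSet]
  rw [this]
  exact ((measurableSet_lt (by fun_prop) measurable_const).inter
    (measurableSet_lt (by fun_prop) (by fun_prop))).inter
    ((measurableSet_lt (by fun_prop) measurable_const).inter
    (measurableSet_lt (by fun_prop) (by fun_prop)))

/-- `diamondE` is measurable. [folklore] -/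
theorem measurableSet_diamondE : MeasurableSet diamondE := by
  have : diamondE = {p : E × (E × E) | dist p.2.1 0 < 1} ∩ ringE := by
    ext p; simp [diamondE, ringE]
  rw [this]
  exact (measurableSet_lt (by fun_prop) measurable_const).inter measurableSet_ringE

/-- `vol(ringE) = ∫ lensFun(‖b‖)² db`. [folklore] -/
theorem volume_ringE_eq_lintegral :
    volume ringE = ∫⁻ b : E, ENNReal.ofReal (lensFun ‖b‖) * ENNReal.ofReal (lensFun ‖b‖) := by
  rw [Measure.volume_eq_prod, Measure.prod_apply_symm measurableSet_ringE]
  have : ∀ y : E × E, volume ((fun a : E => (a, y)) ⁻¹' ringE) =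
      {y : E × E | y.2 ∈ lensSet y.1}.indicator (fun y => ENNReal.ofReal (lensFun ‖y.1‖)) y := by
    intro y
    by_cases hy : y.2 ∈ lensSet y.1
    · rw [indicator_of_mem (show y ∈ {y : E × E | y.2 ∈ lensSet y.1} from hy)]
      have : (fun a : E => (a, y)) ⁻¹' ringE = lensSet y.1 := by
        ext a; simp [ringE, hy]
      rw [this, volume_lensSet]
    · rw [indicator_of_notMem (show y ∉ {y : E × E | y.2 ∈ lensSet y.1} from hy)]
      have : (fun a : E => (a, y)) ⁻¹' ringE = ∅ := by
        ext a; simp [ringE, hy]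
      rw [this, measure_empty]
  simp_rw [this]
  exact lintegral_pair_indicator _ measurable_ofReal_lensFun_norm

/-- `vol(diamondE) = ∫_{‖b‖<1} lensFun(‖b‖)² db`. [folklore] -/
theorem volume_diamondE_eq_lintegral :
    volume diamondE = ∫⁻ b : E, (ball (0 : E) 1).indicator
      (fun b => ENNReal.ofReal (lensFun ‖b‖)) b * ENNReal.ofReal (lensFun ‖b‖) := by
  rw [Measure.volume_eq_prod, Measure.prod_apply_symm measurableSet_diamondE]
  have : ∀ y : E × E, volume ((fun a : E => (a, y)) ⁻¹' diamondE) =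
      {y : E × E | y.2 ∈ lensSet y.1}.indicator
        (fun y => (ball (0 : E) 1).indicator (fun b => ENNReal.ofReal (lensFun ‖b‖)) y.1) y := by
    intro y
    by_cases hy : y.2 ∈ lensSet y.1
    · rw [indicator_of_mem (show y ∈ {y : E × E | y.2 ∈ lensSet y.1} from hy)]
      by_cases hb : y.1 ∈ ball (0 : E) 1
      · rw [indicator_of_mem hb]
        have hb' : ‖y.1‖ < 1 := by rwa [mem_ball_zero_iff] at hb
        have : (fun a : E => (a, y)) ⁻¹' diamondE = lensSet y.1 := by
          ext a; simp [diamondE, hy, hb']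
        rw [this, volume_lensSet]
      · rw [indicator_of_notMem hb]
        have : (fun a : E => (a, y)) ⁻¹' diamondE = ∅ := by
          ext a
          simp only [diamondE, mem_preimage, mem_setOf_eq, mem_empty_iff_false, iff_false, not_and]
          intro h; exact absurd (mem_ball.mpr h) hb
        rw [this, measure_empty]
    · rw [indicator_of_notMem (show y ∉ {y : E × E | y.2 ∈ lensSet y.1} from hy)]
      have : (fun a : E => (a, y)) ⁻¹' diamondE = ∅ := by
        ext a; simp [diamondE, hy]
      rw [this, measure_empty]
  simp_rw [this]
  exact lintegral_pair_indicator _ (measurable_ofReal_lensFun_norm.indicator measurableSet_ball)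

/-! ### The radial integrals -/

/-- Antiderivative of `y²(16 − 12y + y³)²`. [folklore] -/
def Qpoly (x : ℝ) : ℝ :=
  256 / 3 * x ^ 3 - 96 * x ^ 4 + 144 / 5 * x ^ 5 + 16 / 3 * x ^ 6 - 24 / 7 * x ^ 7 + 1 / 9 * x ^ 9

/-- `Qpoly' = y²(16 − 12y + y³)²`. [folklore] -/
theorem hasDerivAt_Qpoly (x : ℝ) : HasDerivAt Qpoly (x ^ 2 * (16 - 12 * x + x ^ 3) ^ 2) x := by
  have h := ((((((hasDerivAt_pow 3 x).const_mul (256 / 3)).sub ((hasDerivAt_pow 4 x).const_mul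
    96)).add ((hasDerivAt_pow 5 x).const_mul (144 / 5))).add ((hasDerivAt_pow 6 x).const_mul
    (16 / 3))).sub ((hasDerivAt_pow 7 x).const_mul (24 / 7))).add
    ((hasDerivAt_pow 9 x).const_mul (1 / 9))
  refine h.congr_deriv ?_
  push_cast
  ring

/-- `∫_a^b y²(16 − 12y + y³)² dy = Qpoly b − Qpoly a`. [folklore] -/
theorem integral_poly (a b : ℝ) :
    ∫ y in a..b, y ^ 2 * (16 - 12 * y + y ^ 3) ^ 2 = Qpoly b - Qpoly a :=
  integral_eq_sub_of_hasDerivAt (fun x _ => hasDerivAt_Qpoly x)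
    ((by fun_prop : Continuous fun y : ℝ => y ^ 2 * (16 - 12 * y + y ^ 3) ^ 2).intervalIntegrable
      _ _)

/-- `y² lensVol(y)² = (π²/144)·y²(16 − 12y + y³)²`. [folklore] -/
theorem sq_mul_lensVol_sq (y : ℝ) :
    y ^ 2 * lensVol y ^ 2 = π ^ 2 / 144 * (y ^ 2 * (16 - 12 * y + y ^ 3) ^ 2) := by
  simp only [lensVol]; ring

/-- `vol B(0,1) = 4π/3` in `E`, as a real number. [folklore] -/
theorem volume_real_unitBall : (volume : Measure E).real (ball 0 1) = 4 * π / 3 := by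
  rw [measureReal_def, EuclideanSpace.volume_ball_fin_three]
  rw [ENNReal.toReal_mul, ← ENNReal.ofReal_pow zero_le_one, ENNReal.toReal_ofReal (by positivity),
    ENNReal.toReal_ofReal (by positivity)]
  ring

/-- `dim E = 3`. [folklore] -/
theorem finrank_E : Module.finrank ℝ E = 3 := finrank_euclideanSpace_fin

/-- **Radial integration in `ℝ³`**: `∫ h(‖b‖) db = 4π ∫₀^∞ y² h(y) dy`
(`integral_fun_norm_addHaar`). [folklore] -/
theorem integral_norm_E (h : ℝ → ℝ) :
    ∫ b : E, h ‖b‖ = 4 * π * ∫ y in Ioi (0 : ℝ), y ^ 2 * h y := by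
  rw [integral_fun_norm_addHaar volume h, finrank_E, volume_real_unitBall]
  simp only [nsmul_eq_mul, smul_eq_mul, Nat.cast_ofNat]
  have : (3 : ℕ) - 1 = 2 := rfl
  simp only [this]
  ring

/-- `b ↦ lensFun(‖b‖)²` has compact support (it vanishes outside `B̄(0,2)`). [folklore] -/
theorem lensFun_norm_sq_hasCompactSupport :
    HasCompactSupport fun b : E => lensFun ‖b‖ ^ 2 := by
  apply HasCompactSupport.intro (isCompact_closedBall (0 : E) 2)
  intro b hb
  rw [mem_closedBall_zero_iff, not_le] at hb
  simp [lensFun_of_gt hb]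

/-- `b ↦ lensFun(‖b‖)²` is integrable. [folklore] -/
theorem integrable_lensFun_norm_sq : Integrable fun b : E => lensFun ‖b‖ ^ 2 :=
  ((continuous_lensFun.comp continuous_norm).pow 2).integrable_of_hasCompactSupport
    lensFun_norm_sq_hasCompactSupport

/-- `∫₀^∞ y² 𝟙[y<c] lensFun(y)² dy = (π²/144)(Qpoly c − Qpoly 0)` for `0 < c ≤ 2`. [folklore] -/
theorem setIntegral_Ioi_lens {c : ℝ} (hc0 : 0 < c) (hc2 : c ≤ 2) :
    ∫ y in Ioi (0 : ℝ), y ^ 2 * (Iio c).indicator (fun y => lensFun y ^ 2) y =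
      π ^ 2 / 144 * (Qpoly c - Qpoly 0) := by
  have h1 : ∀ y, y ^ 2 * (Iio c).indicator (fun y => lensFun y ^ 2) y =
      (Iio c).indicator (fun y => y ^ 2 * lensFun y ^ 2) y := by
    intro y
    by_cases hy : y ∈ Iio c <;> simp [hy]
  simp_rw [h1]
  rw [setIntegral_indicator measurableSet_Iio, Ioi_inter_Iio, ← integral_Ioc_eq_integral_Ioo,
    ← integral_of_le hc0.le]
  have h2 : ∫ y in (0 : ℝ)..c, y ^ 2 * lensFun y ^ 2 =
      ∫ y in (0 : ℝ)..c, π ^ 2 / 144 * (y ^ 2 * (16 - 12 * y + y ^ 3) ^ 2) := by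
    apply integral_congr
    intro y hy
    rw [uIcc_of_le hc0.le] at hy
    simp only
    rw [lensFun_of_le (by linarith [hy.2]), sq_mul_lensVol_sq]
  rw [h2, intervalIntegral.integral_const_mul, integral_poly]

/-- `Qpoly 0 = 0`. [folklore] -/
theorem Qpoly_zero : Qpoly 0 = 0 := by simp [Qpoly]
/-- `Qpoly 1 = 6347/315`. [folklore] -/
theorem Qpoly_one : Qpoly 1 = 6347 / 315 := by simp [Qpoly]; norm_num
/-- `Qpoly 2 = 8704/315`. [folklore] -/
theorem Qpoly_two : Qpoly 2 = 8704 / 315 := by simp [Qpoly]; norm_num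

/-- **Volume of the ring set (block form)**: `2176 π³/2835`. [folklore] -/
theorem volume_ringE : volume ringE = ENNReal.ofReal (2176 * π ^ 3 / 2835) := by
  rw [volume_ringE_eq_lintegral]
  have h1 : ∀ b : E, ENNReal.ofReal (lensFun ‖b‖) * ENNReal.ofReal (lensFun ‖b‖) =
      ENNReal.ofReal (lensFun ‖b‖ ^ 2) := by
    intro b
    rw [← ENNReal.ofReal_mul (lensFun_nonneg _ (norm_nonneg b)), sq]
  simp_rw [h1]
  rw [← ofReal_integral_eq_lintegral_ofReal integrable_lensFun_norm_sq
    (ae_of_all _ fun b => sq_nonneg _)]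
  congr 1
  have h2 : ∀ b : E, lensFun ‖b‖ ^ 2 =
      (fun y => (Iio 2).indicator (fun y => lensFun y ^ 2) y) ‖b‖ := by
    intro b
    by_cases hb : ‖b‖ ∈ Iio (2 : ℝ)
    · simp [hb]
    · have hb2 : 2 ≤ ‖b‖ := by simpa using hb
      simp only [indicator_of_notMem hb]
      rcases hb2.eq_or_lt with h | h
      · rw [← h, lensFun_of_le le_rfl, lensVol_two]; ring
      · rw [lensFun_of_gt h]; ring
  simp_rw [h2]
  rw [integral_norm_E, setIntegral_Ioi_lens two_pos le_rfl, Qpoly_two, Qpoly_zero]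
  ring

/-- **Volume of the diamond set (block form)**: `6347 π³/11340`. [folklore] -/
theorem volume_diamondE : volume diamondE = ENNReal.ofReal (6347 * π ^ 3 / 11340) := by
  rw [volume_diamondE_eq_lintegral]
  have h1 : ∀ b : E, (ball (0 : E) 1).indicator (fun b => ENNReal.ofReal (lensFun ‖b‖)) b *
      ENNReal.ofReal (lensFun ‖b‖) =
      ENNReal.ofReal ((fun y => (Iio 1).indicator (fun y => lensFun y ^ 2) y) ‖b‖) := by
    intro b
    by_cases hb : b ∈ ball (0 : E) 1
    · have hb' : ‖b‖ ∈ Iio (1 : ℝ) := by simpa using hb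
      simp only [indicator_of_mem hb, indicator_of_mem hb']
      rw [← ENNReal.ofReal_mul (lensFun_nonneg _ (norm_nonneg b)), sq]
    · have hb' : ‖b‖ ∉ Iio (1 : ℝ) := by simpa using hb
      simp only [indicator_of_notMem hb, indicator_of_notMem hb', zero_mul, ENNReal.ofReal_zero]
  simp_rw [h1]
  have hint : Integrable fun b : E =>
      (fun y => (Iio 1).indicator (fun y => lensFun y ^ 2) y) ‖b‖ := by
    have : (fun b : E => (fun y => (Iio 1).indicator (fun y => lensFun y ^ 2) y) ‖b‖) =
        (ball (0 : E) 1).indicator fun b => lensFun ‖b‖ ^ 2 := by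
      ext b
      by_cases hb : b ∈ ball (0 : E) 1
      · have hb' : ‖b‖ ∈ Iio (1 : ℝ) := by simpa using hb
        simp only [indicator_of_mem hb, indicator_of_mem hb']
      · have hb' : ‖b‖ ∉ Iio (1 : ℝ) := by simpa using hb
        simp only [indicator_of_notMem hb, indicator_of_notMem hb']
    rw [this]
    exact integrable_lensFun_norm_sq.indicator measurableSet_ball
  rw [← ofReal_integral_eq_lintegral_ofReal hint (ae_of_all _ fun b => ?_)]
  swap
  · simp only
    by_cases hb : ‖b‖ ∈ Iio (1 : ℝ)
    · simp only [indicator_of_mem hb]; exact sq_nonneg _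
    · simp only [indicator_of_notMem hb]; exact le_rfl
  congr 1
  rw [integral_norm_E, setIntegral_Ioi_lens one_pos (by norm_num), Qpoly_one, Qpoly_zero]
  ring

/-! ### Back to `Fin 9 → ℝ` -/

/-- The fact's ring set is the `cfg`-preimage of the literal block-form ring set. [folklore] -/
theorem ring_eq_preimage : hardSphereRingFour = cfg ⁻¹'
    {p : E × (E × E) | ‖p.1‖ < 1 ∧ dist p.1 p.2.1 < 1 ∧ dist p.2.1 p.2.2 < 1 ∧ ‖p.2.2‖ < 1} := by
  ext x
  obtain ⟨h0, h1, h2, h3, h4, h5, h6, h7, h8⟩ := cfg_apply x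
  simp only [hardSphereRingFour, mem_setOf_eq, mem_preimage, norm_lt_one_iff, dist_lt_one_iff,
    h0, h1, h2, h3, h4, h5, h6, h7, h8]

/-- Literal block-form ring set `=` `ringE`. [folklore] -/
theorem ringLit_eq_ringE :
    {p : E × (E × E) | ‖p.1‖ < 1 ∧ dist p.1 p.2.1 < 1 ∧ dist p.2.1 p.2.2 < 1 ∧ ‖p.2.2‖ < 1} =
      ringE := by
  ext p
  simp only [mem_setOf_eq, ringE, mem_lensSet, dist_zero_right, dist_comm p.2.2 p.2.1]
  tauto

/-- The fact's diamond set is the `cfg`-preimage of the literal block-form diamond set.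
[folklore] -/
theorem diamond_eq_preimage : hardSphereDiamondFour = cfg ⁻¹'
    {p : E × (E × E) | ‖p.1‖ < 1 ∧ ‖p.2.1‖ < 1 ∧ dist p.1 p.2.1 < 1 ∧ dist p.2.1 p.2.2 < 1 ∧
      ‖p.2.2‖ < 1} := by
  ext x
  obtain ⟨h0, h1, h2, h3, h4, h5, h6, h7, h8⟩ := cfg_apply x
  simp only [hardSphereDiamondFour, mem_setOf_eq, mem_preimage, norm_lt_one_iff, dist_lt_one_iff,
    h0, h1, h2, h3, h4, h5, h6, h7, h8]

/-- Literal block-form diamond set `=` `diamondE`. [folklore] -/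
theorem diamondLit_eq_diamondE :
    {p : E × (E × E) | ‖p.1‖ < 1 ∧ ‖p.2.1‖ < 1 ∧ dist p.1 p.2.1 < 1 ∧ dist p.2.1 p.2.2 < 1 ∧
      ‖p.2.2‖ < 1} = diamondE := by
  ext p
  simp only [mem_setOf_eq, diamondE, mem_lensSet, dist_zero_right, dist_comm p.2.2 p.2.1]
  tauto

end BoltzmannB4

open BoltzmannB4

/-- **The ring diagram of `B₄` for hard spheres in `ℝ³`**:
`vol{ |r₂| < 1, |r₂ − r₃| < 1, |r₃ − r₄| < 1, |r₄| < 1 } = 2176 π³/2835`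
(`= (272/105)·B₂³` with `B₂ = 2π/3`; the value of Luban–Baram's closed form for the ring at
`D = 3`, cf. Lyberg 2005 §2). [folklore] -/
theorem volume_hardSphereRingFour :
    volume hardSphereRingFour = ENNReal.ofReal (2176 * π ^ 3 / 2835) := by
  rw [ring_eq_preimage, ringLit_eq_ringE,
    volume_preserving_cfg.measure_preimage measurableSet_ringE.nullMeasurableSet, volume_ringE]

/-- **The diamond diagram of `B₄` for hard spheres in `ℝ³`** (configuration-set volume):
`vol(◇) = 6347 π³/11340` (`= (6347/3360)·B₂³`; cf. Lyberg 2005 §2). [folklore] -/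
theorem volume_hardSphereDiamondFour :
    volume hardSphereDiamondFour = ENNReal.ofReal (6347 * π ^ 3 / 11340) := by
  rw [diamond_eq_preimage, diamondLit_eq_diamondE,
    volume_preserving_cfg.measure_preimage measurableSet_diamondE.nullMeasurableSet,
    volume_diamondE]

/-- Real-valued form of `volume_hardSphereRingFour`. [folklore] -/
theorem volume_hardSphereRingFour_toReal :
    (volume hardSphereRingFour).toReal = 2176 * π ^ 3 / 2835 := by
  rw [volume_hardSphereRingFour, ENNReal.toReal_ofReal (by positivity)]

/-- Real-valued form of `volume_hardSphereDiamondFour`. [folklore] -/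
theorem volume_hardSphereDiamondFour_toReal :
    (volume hardSphereDiamondFour).toReal = 6347 * π ^ 3 / 11340 := by
  rw [volume_hardSphereDiamondFour, ENNReal.toReal_ofReal (by positivity)]



/-! ## Part 2: the complete star reduces to the two-centre lens pair at contact

`vol(hardSphereStarFour) = (8π/3) · vol(lensPair e0)`, where
`lensPair e0 = {(b,c) : ‖b‖, ‖c‖, |e0 − b|, |e0 − c|, |b − c| < 1}` is the two-centre
configuration set of the complete star with the pinned pair at distance exactly `1`. This is
Lyberg's display (13) (`[cs] = −4B₂ χ(1)`, Nijboer–van Hove's two-centre formalism), proved here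
without the `∂/∂σ` argument: partition `{all six distances < 1}` by WHICH distance is the largest
(six pieces of equal volume by the relabelling symmetries of the four particles, ties being null),
and on the piece where `‖a‖` is largest scale `(b,c)` by `‖a‖` (Jacobian `‖a‖⁶`) and rotate `a` to
the axis: `vol = 6 · (∫_{‖a‖<1} ‖a‖⁶ da) · vol(lensPair e0) = 6 · (4π/9) · vol(lensPair e0)`.
-/

namespace BoltzmannB4

local notation "E" => EuclideanSpace ℝ (Fin 3)
local notation "X" => EuclideanSpace ℝ (Fin 3) × (EuclideanSpace ℝ (Fin 3) × EuclideanSpace ℝ (Fin 3))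



/-- the six mutual distances of the configuration `(0, a, b, c)` [folklore] -/
def dv (p : X) : Fin 6 → ℝ :=
  ![‖p.1‖, ‖p.2.1‖, ‖p.2.2‖, dist p.1 p.2.1, dist p.1 p.2.2, dist p.2.1 p.2.2]

/-- Component 0 of the distance vector `dv`. [folklore] -/
@[simp] theorem dv_0 (p : X) : dv p 0 = ‖p.1‖ := rfl
/-- Component 1 of the distance vector `dv`. [folklore] -/
@[simp] theorem dv_1 (p : X) : dv p 1 = ‖p.2.1‖ := rfl
/-- Component 2 of the distance vector `dv`. [folklore] -/
@[simp] theorem dv_2 (p : X) : dv p 2 = ‖p.2.2‖ := rfl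
/-- Component 3 of the distance vector `dv`. [folklore] -/
@[simp] theorem dv_3 (p : X) : dv p 3 = dist p.1 p.2.1 := rfl
/-- Component 4 of the distance vector `dv`. [folklore] -/
@[simp] theorem dv_4 (p : X) : dv p 4 = dist p.1 p.2.2 := rfl
/-- Component 5 of the distance vector `dv`. [folklore] -/
@[simp] theorem dv_5 (p : X) : dv p 5 = dist p.2.1 p.2.2 := rfl

/-- Each distance is continuous. [folklore] -/
theorem continuous_dv (j : Fin 6) : Continuous fun p : X => dv p j := by
  fin_cases j <;> simp <;> fun_prop

/-- the complete-star configuration set [folklore] -/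
def starE : Set X := {p | ∀ j, dv p j < 1}

/-- the piece where distance `k` is the strict maximum [folklore] -/
def piece (k : Fin 6) : Set X := {p | (∀ j, dv p j < 1) ∧ ∀ j, j ≠ k → dv p j < dv p k}

/-- the tie sets [folklore] -/
def tie (j k : Fin 6) : Set X := {p | dv p j = dv p k}

/-- `starE` is measurable. [folklore] -/
theorem measurableSet_starE : MeasurableSet starE := by
  have : starE = ⋂ j, {p : X | dv p j < 1} := by ext p; simp [starE]
  rw [this]
  exact MeasurableSet.iInter fun j => measurableSet_lt (continuous_dv j).measurable measurable_const

/-- `piece k` is measurable. [folklore] -/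
theorem measurableSet_piece (k : Fin 6) : MeasurableSet (piece k) := by
  have : piece k = starE ∩ ⋂ j, {p : X | j ≠ k → dv p j < dv p k} := by
    ext p; simp [piece, starE]
  rw [this]
  refine measurableSet_starE.inter (MeasurableSet.iInter fun j => ?_)
  by_cases hj : j = k
  · simp [hj]
  · simp only [hj, ne_eq, not_false_eq_true, forall_const]
    exact measurableSet_lt (continuous_dv j).measurable (continuous_dv k).measurable

/-- `tie j k` is measurable. [folklore] -/
theorem measurableSet_tie (j k : Fin 6) : MeasurableSet (tie j k) :=
  measurableSet_eq_fun (continuous_dv j).measurable (continuous_dv k).measurable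

/-- `piece k ⊆ starE`. [folklore] -/
theorem piece_subset (k : Fin 6) : piece k ⊆ starE := fun _ hp => hp.1

/-- The pieces are pairwise disjoint. [folklore] -/
theorem piece_disjoint {j k : Fin 6} (h : j ≠ k) : Disjoint (piece j) (piece k) := by
  rw [Set.disjoint_left]
  intro p hj hk
  have h1 := hj.2 k (Ne.symm h)
  have h2 := hk.2 j h
  linarith

/-- `starE` minus the pieces is contained in the ties (take an index where the distance is maximal). [folklore] -/
theorem starE_diff_subset : starE \ (⋃ k, piece k) ⊆ ⋃ j, ⋃ k, ⋃ (_ : j ≠ k), tie j k := by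
  intro p hp
  obtain ⟨hS, hU⟩ := hp
  simp only [mem_iUnion, not_exists] at hU ⊢
  -- let k be an index where dv is maximal
  obtain ⟨k, -, hk⟩ := Finset.exists_max_image Finset.univ (fun j => dv p j) Finset.univ_nonempty
  have hk' : ∀ j, dv p j ≤ dv p k := fun j => hk j (Finset.mem_univ j)
  have : ¬ (∀ j, j ≠ k → dv p j < dv p k) := fun h => hU k ⟨hS, h⟩
  push Not at this
  obtain ⟨j, hjk, hj⟩ := this
  exact ⟨j, k, hjk, le_antisymm (hk' j) hj⟩

/-- a symmetry permuting the distance vector maps pieces to pieces [folklore] -/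
theorem preimage_piece {Φ : X → X} {σ : Equiv.Perm (Fin 6)} (h : ∀ p j, dv (Φ p) j = dv p (σ j))
    (k : Fin 6) : Φ ⁻¹' piece k = piece (σ k) := by
  ext p
  simp only [mem_preimage, piece, mem_setOf_eq, h]
  constructor
  · rintro ⟨h1, h2⟩
    refine ⟨fun j => by simpa using h1 (σ.symm j), fun j hj => ?_⟩
    have := h2 (σ.symm j) (by intro hh; apply hj; rw [← hh]; simp)
    simpa using this
  · rintro ⟨h1, h2⟩
    exact ⟨fun j => h1 (σ j), fun j hj => h2 (σ j) (by intro hh; exact hj (σ.injective hh))⟩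

/-- Hence a measure-preserving such map identifies the volumes of the corresponding pieces. [folklore] -/
theorem volume_piece_eq {Φ : X → X} (hΦ : MeasurePreserving Φ volume volume) {σ : Equiv.Perm (Fin 6)}
    (h : ∀ p j, dv (Φ p) j = dv p (σ j)) (k : Fin 6) :
    volume (piece (σ k)) = volume (piece k) := by
  rw [← preimage_piece h k, hΦ.measure_preimage (measurableSet_piece k).nullMeasurableSet]

/-! symmetry maps -/

/-- swap `a ↔ b` [folklore] -/
def swapAB (p : X) : X := (p.2.1, (p.1, p.2.2))
/-- swap `b ↔ c` [folklore] -/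
def swapBC (p : X) : X := (p.1, (p.2.2, p.2.1))
/-- move the origin to `a`: `(a,b,c) ↦ (-a, (b,c) - (a,a))` [folklore] -/
def shiftA (p : X) : X := (-p.1, p.2 - (p.1, p.1))

/-- `swapBC` preserves volume. [folklore] -/
theorem measurePreserving_swapBC : MeasurePreserving swapBC (volume : Measure X) volume := by
  have h1 : MeasurePreserving (Prod.swap : E × E → E × E) volume volume :=
    (Measure.measurePreserving_swap (μ := (volume : Measure E)) (ν := (volume : Measure E)))
  have := (MeasurePreserving.id (volume : Measure E)).prod h1
  exact this

/-- `swapAB` preserves volume. [folklore] -/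
theorem measurePreserving_swapAB : MeasurePreserving swapAB (volume : Measure X) volume := by
  -- swapAB = assoc ∘ (swap × id) ∘ assoc⁻¹
  have hA : MeasurePreserving (MeasurableEquiv.prodAssoc : (E × E) × E ≃ᵐ X) volume volume := by
    have := measurePreserving_prodAssoc (volume : Measure E) (volume : Measure E) (volume : Measure E)
    simpa [Measure.volume_eq_prod] using this
  have hS : MeasurePreserving (fun q : (E × E) × E => (q.1.swap, q.2)) volume volume :=
    (Measure.measurePreserving_swap (μ := (volume : Measure E)) (ν := (volume : Measure E))).prod
      (MeasurePreserving.id (volume : Measure E))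
  have := (hA.comp hS).comp hA.symm
  have heq : swapAB = (⇑MeasurableEquiv.prodAssoc ∘ fun q : (E × E) × E => (q.1.swap, q.2)) ∘
      ⇑(MeasurableEquiv.prodAssoc : (E × E) × E ≃ᵐ X).symm := by
    funext p; rfl
  rw [heq]; exact this

/-- `shiftA` preserves volume (a shear composed with a negation). [folklore] -/
theorem measurePreserving_shiftA : MeasurePreserving shiftA (volume : Measure X) volume := by
  have hneg : MeasurePreserving (fun a : E => -a) (volume : Measure E) volume :=
    Measure.measurePreserving_neg volume
  have hsub : ∀ a : E, MeasurePreserving (fun y : E × E => y - (a, a))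
      ((volume : Measure E).prod (volume : Measure E)) ((volume : Measure E).prod volume) :=
    fun a => measurePreserving_sub_right ((volume : Measure E).prod (volume : Measure E)) (a, a)
  have := MeasurePreserving.skew_product (g := fun (a : E) (y : E × E) => y - (a, a)) hneg
    (by fun_prop) (ae_of_all _ fun a => (hsub a).map_eq)
  exact this

/-- permutation of the distances under `swapAB` [folklore] -/
def σAB : Equiv.Perm (Fin 6) := Equiv.ofBijective ![1, 0, 2, 3, 5, 4] (by decide)
/-- permutation of the distances under `swapBC` [folklore] -/
def σBC : Equiv.Perm (Fin 6) := Equiv.ofBijective ![0, 2, 1, 4, 3, 5] (by decide)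
/-- permutation of the distances under `shiftA` [folklore] -/
def σA : Equiv.Perm (Fin 6) := Equiv.ofBijective ![0, 3, 4, 1, 2, 5] (by decide)

/-- Distances under `swapAB`. [folklore] -/
theorem dv_swapAB (p : X) (j : Fin 6) : dv (swapAB p) j = dv p (σAB j) := by
  fin_cases j <;> simp [swapAB, dv, σAB, dist_comm]

/-- Distances under `swapBC`. [folklore] -/
theorem dv_swapBC (p : X) (j : Fin 6) : dv (swapBC p) j = dv p (σBC j) := by
  fin_cases j <;> simp [swapBC, dv, σBC, dist_comm]

/-- Distances under `shiftA`. [folklore] -/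
theorem dv_shiftA (p : X) (j : Fin 6) : dv (shiftA p) j = dv p (σA j) := by
  have h1 : ∀ a b : E, ‖b - a‖ = dist a b := fun a b => by rw [dist_eq_norm, norm_sub_rev]
  have h3 : ∀ a b : E, dist (-a) (b - a) = ‖b‖ := fun a b => by
    rw [dist_eq_norm, show -a - (b - a) = -b by abel, norm_neg]
  fin_cases j <;> simp [shiftA, dv, σA, h1, h3]


/-! ### ties are null -/

/-- A measurable subset of `E × (E × E)` all of whose `a`-slices are null (a.e.) is null. [folklore] -/
theorem null_of_slices {s : Set X} (hs : MeasurableSet s)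
    (h : ∀ᵐ y : E × E, volume ((fun a : E => (a, y)) ⁻¹' s) = 0) : volume s = 0 := by
  rw [Measure.volume_eq_prod, Measure.prod_apply_symm hs]
  rw [lintegral_congr_ae (g := fun _ => 0) h, lintegral_zero]

/-- A measurable subset of `E × E` all of whose first-coordinate slices are null (a.e.) is null. [folklore] -/
theorem null_of_slices2 {s : Set (E × E)} (hs : MeasurableSet s)
    (h : ∀ᵐ c : E, volume ((fun b : E => (b, c)) ⁻¹' s) = 0) : volume s = 0 := by
  rw [Measure.volume_eq_prod, Measure.prod_apply_symm hs]
  rw [lintegral_congr_ae (g := fun _ => 0) h, lintegral_zero]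

/-- Spheres are Lebesgue-null in `E`. [folklore] -/
theorem volume_sphere_E (x : E) (r : ℝ) : volume (sphere x r) = 0 :=
  Measure.addHaar_sphere volume x r

/-- Perpendicular bisector planes are Lebesgue-null in `E`. [folklore] -/
theorem volume_bisector_E {x y : E} (h : x ≠ y) : volume {a : E | dist a x = dist a y} = 0 := by
  have : {a : E | dist a x = dist a y} = (AffineSubspace.perpBisector x y : Set E) := by
    ext a; simp [AffineSubspace.mem_perpBisector_iff_dist_eq]
  rw [this]
  apply Measure.addHaar_affineSubspace
  rwa [Ne, AffineSubspace.perpBisector_eq_top]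

/-- tie sets whose `a`-slices are spheres are null [folklore] -/
theorem tie_null_sphere {j k : Fin 6} (ctr : E × E → E) (rad : E × E → ℝ)
    (h : ∀ (a : E) (y : E × E), dv (a, y) j = dv (a, y) k ↔ dist a (ctr y) = rad y) :
    volume (tie j k) = 0 := by
  apply null_of_slices (measurableSet_tie j k) (ae_of_all _ fun y => ?_)
  have : (fun a : E => (a, y)) ⁻¹' tie j k = sphere (ctr y) (rad y) := by
    ext a; simp [tie, h, dist_eq_norm]
  rw [this, volume_sphere_E]

/-- tie sets whose `a`-slices are bisector planes (a.e.) are null [folklore] -/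
theorem tie_null_bisector {j k : Fin 6} (p₁ p₂ : E × E → E) (hne : ∀ᵐ y : E × E, p₁ y ≠ p₂ y)
    (h : ∀ (a : E) (y : E × E), dv (a, y) j = dv (a, y) k ↔ dist a (p₁ y) = dist a (p₂ y)) :
    volume (tie j k) = 0 := by
  apply null_of_slices (measurableSet_tie j k)
  filter_upwards [hne] with y hy
  have : (fun a : E => (a, y)) ⁻¹' tie j k = {a | dist a (p₁ y) = dist a (p₂ y)} := by
    ext a; simp [tie, h]
  rw [this, volume_bisector_E hy]

/-- tie sets depending only on `(b,c)` through a null set are null [folklore] -/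
theorem tie_null_inner {j k : Fin 6} (N : Set (E × E)) (hN : volume N = 0)
    (h : ∀ (a : E) (y : E × E), dv (a, y) j = dv (a, y) k ↔ y ∈ N) :
    volume (tie j k) = 0 := by
  have : tie j k = (univ : Set E) ×ˢ N := by
    ext ⟨a, y⟩; simp [tie, h]
  rw [this, Measure.volume_eq_prod, Measure.prod_prod, hN, mul_zero]

/-- `b ≠ 0` for a.e. `(b, c)`. [folklore] -/
theorem ae_fst_ne_zero : ∀ᵐ y : E × E, y.1 ≠ 0 := by
  have : volume {y : E × E | y.1 = 0} = 0 := by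
    have : {y : E × E | y.1 = 0} = ({0} : Set E) ×ˢ (univ : Set E) := by
      ext y; simp
    rw [this, Measure.volume_eq_prod, Measure.prod_prod, measure_singleton, zero_mul]
  exact measure_eq_zero_iff_ae_notMem.mp this

/-- `c ≠ 0` for a.e. `(b, c)`. [folklore] -/
theorem ae_snd_ne_zero : ∀ᵐ y : E × E, y.2 ≠ 0 := by
  have : volume {y : E × E | y.2 = 0} = 0 := by
    have : {y : E × E | y.2 = 0} = (univ : Set E) ×ˢ ({0} : Set E) := by
      ext y; simp
    rw [this, Measure.volume_eq_prod, Measure.prod_prod, measure_singleton, mul_zero]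
  exact measure_eq_zero_iff_ae_notMem.mp this

/-- `b ≠ c` for a.e. `(b, c)`. [folklore] -/
theorem ae_fst_ne_snd : ∀ᵐ y : E × E, y.1 ≠ y.2 := by
  have : volume {y : E × E | y.1 = y.2} = 0 := by
    apply null_of_slices2 (measurableSet_eq_fun measurable_fst measurable_snd) (ae_of_all _ fun c => ?_)
    have : (fun b : E => (b, c)) ⁻¹' {y : E × E | y.1 = y.2} = {c} := by
      ext b; simp
    rw [this, measure_singleton]
  exact measure_eq_zero_iff_ae_notMem.mp this

/-- **All fifteen tie sets are null** (twelve by slicing in `a` — spheres or bisector planes — and three inner ones by slicing in `b`). [folklore] -/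
theorem volume_tie (j k : Fin 6) (hjk : j ≠ k) : volume (tie j k) = 0 := by
  -- reduce to j < k
  wlog hlt : j < k generalizing j k
  · have hswap : tie j k = tie k j := by ext p; simp [tie, eq_comm]
    rw [hswap]
    exact this k j hjk.symm (lt_of_le_of_ne (not_lt.mp hlt) hjk.symm)
  fin_cases j <;> fin_cases k <;> simp at hlt
  -- (0,1) sphere 0 ‖b‖
  · exact tie_null_sphere (fun y => 0) (fun y => ‖y.1‖) (fun a y => by simp [dv])
  -- (0,2)
  · exact tie_null_sphere (fun y => 0) (fun y => ‖y.2‖) (fun a y => by simp [dv])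
  -- (0,3): ‖a‖ = dist a b : bisector of 0 and b
  · exact tie_null_bisector (fun y => 0) (fun y => y.1) (by simpa [eq_comm] using ae_fst_ne_zero)
      (fun a y => by simp [dv])
  -- (0,4)
  · exact tie_null_bisector (fun y => 0) (fun y => y.2) (by simpa [eq_comm] using ae_snd_ne_zero)
      (fun a y => by simp [dv])
  -- (0,5): ‖a‖ = dist b c : sphere 0 (dist b c)
  · exact tie_null_sphere (fun y => 0) (fun y => dist y.1 y.2) (fun a y => by simp [dv])
  -- (1,2): inner, ‖b‖ = ‖c‖
  · apply tie_null_inner {y : E × E | ‖y.1‖ = ‖y.2‖} ?_ (fun a y => by simp [dv])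
    apply null_of_slices2 (measurableSet_eq_fun (by fun_prop) (by fun_prop)) (ae_of_all _ fun c => ?_)
    have : (fun b : E => (b, c)) ⁻¹' {y : E × E | ‖y.1‖ = ‖y.2‖} = sphere 0 ‖c‖ := by
      ext b; simp
    rw [this, volume_sphere_E]
  -- (1,3): ‖b‖ = dist a b : sphere b ‖b‖
  · exact tie_null_sphere (fun y => y.1) (fun y => ‖y.1‖) (fun a y => by simp [dv, eq_comm])
  -- (1,4): ‖b‖ = dist a c : sphere c ‖b‖
  · exact tie_null_sphere (fun y => y.2) (fun y => ‖y.1‖) (fun a y => by simp [dv, eq_comm])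
  -- (1,5): inner, ‖b‖ = dist b c : bisector of 0,c in b
  · apply tie_null_inner {y : E × E | ‖y.1‖ = dist y.1 y.2} ?_ (fun a y => by simp [dv])
    apply null_of_slices2 (measurableSet_eq_fun (by fun_prop) (by fun_prop))
    have hc : ∀ᵐ c : E, c ≠ 0 := by
      have : volume ({0} : Set E) = 0 := measure_singleton 0
      exact measure_eq_zero_iff_ae_notMem.mp this
    filter_upwards [hc] with c hc
    have : (fun b : E => (b, c)) ⁻¹' {y : E × E | ‖y.1‖ = dist y.1 y.2} =
        {b : E | dist b 0 = dist b c} := by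
      ext b; simp
    rw [this, volume_bisector_E (Ne.symm hc)]
  -- (2,3): ‖c‖ = dist a b : sphere b ‖c‖
  · exact tie_null_sphere (fun y => y.1) (fun y => ‖y.2‖) (fun a y => by simp [dv, eq_comm])
  -- (2,4): ‖c‖ = dist a c : sphere c ‖c‖
  · exact tie_null_sphere (fun y => y.2) (fun y => ‖y.2‖) (fun a y => by simp [dv, eq_comm])
  -- (2,5): inner, ‖c‖ = dist b c : sphere c ‖c‖ in b
  · apply tie_null_inner {y : E × E | ‖y.2‖ = dist y.1 y.2} ?_ (fun a y => by simp [dv])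
    apply null_of_slices2 (measurableSet_eq_fun (by fun_prop) (by fun_prop)) (ae_of_all _ fun c => ?_)
    have : (fun b : E => (b, c)) ⁻¹' {y : E × E | ‖y.2‖ = dist y.1 y.2} = sphere c ‖c‖ := by
      ext b; simp only [mem_preimage, mem_setOf_eq, mem_sphere, dist_eq_norm]; exact eq_comm
    rw [this, volume_sphere_E]
  -- (3,4): dist a b = dist a c : bisector of b, c
  · exact tie_null_bisector (fun y => y.1) (fun y => y.2) ae_fst_ne_snd (fun a y => by simp [dv])
  -- (3,5): dist a b = dist b c : sphere b (dist b c)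
  · exact tie_null_sphere (fun y => y.1) (fun y => dist y.1 y.2) (fun a y => by simp [dv])
  -- (4,5): dist a c = dist b c : sphere c (dist b c)
  · exact tie_null_sphere (fun y => y.2) (fun y => dist y.1 y.2) (fun a y => by simp [dv])

/-- The union of the tie sets is null. [folklore] -/
theorem volume_ties : volume (⋃ j, ⋃ k, ⋃ (_ : j ≠ k), tie j k : Set X) = 0 := by
  refine measure_iUnion_null fun j => measure_iUnion_null fun k => measure_iUnion_null fun h => ?_
  exact volume_tie j k h


/-! ### `vol(starE) = 6 · vol(piece 0)` -/

/-- `σAB 0 = 1`. [folklore] -/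
theorem σAB_0 : σAB 0 = 1 := by simp [σAB]
/-- `σBC 1 = 2`. [folklore] -/
theorem σBC_1 : σBC 1 = 2 := by simp [σBC]
/-- `σA 1 = 3`. [folklore] -/
theorem σA_1 : σA 1 = 3 := by simp [σA]
/-- `σA 2 = 4`. [folklore] -/
theorem σA_2 : σA 2 = 4 := by simp [σA]
/-- `σAB 4 = 5`. [folklore] -/
theorem σAB_4 : σAB 4 = 5 := by simp [σAB]

/-- **All six pieces have the same volume** (the relabelling maps act transitively on the six distances). [folklore] -/
theorem volume_piece_all (k : Fin 6) : volume (piece k) = volume (piece 0) := by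
  have h1 : volume (piece 1) = volume (piece 0) := by
    rw [← σAB_0]; exact volume_piece_eq measurePreserving_swapAB dv_swapAB 0
  have h2 : volume (piece 2) = volume (piece 0) := by
    rw [← h1, ← σBC_1]; exact volume_piece_eq measurePreserving_swapBC dv_swapBC 1
  have h3 : volume (piece 3) = volume (piece 0) := by
    rw [← h1, ← σA_1]; exact volume_piece_eq measurePreserving_shiftA dv_shiftA 1
  have h4 : volume (piece 4) = volume (piece 0) := by
    rw [← h2, ← σA_2]; exact volume_piece_eq measurePreserving_shiftA dv_shiftA 2
  have h5 : volume (piece 5) = volume (piece 0) := by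
    rw [← h4, ← σAB_4]; exact volume_piece_eq measurePreserving_swapAB dv_swapAB 4
  fin_cases k
  · rfl
  · exact h1
  · exact h2
  · exact h3
  · exact h4
  · exact h5

/-- `vol(starE) = 6 · vol(piece 0)` (pieces disjoint, ties null). [folklore] -/
theorem volume_starE_eq : volume starE = 6 * volume (piece 0) := by
  have hU : volume (⋃ k, piece k) = 6 * volume (piece 0) := by
    rw [measure_iUnion (fun j k hjk => piece_disjoint hjk) measurableSet_piece, tsum_fintype]
    simp only [volume_piece_all, Finset.sum_const, Finset.card_univ, Fintype.card_fin, nsmul_eq_mul,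
      Nat.cast_ofNat]
  rw [← hU]
  apply le_antisymm
  · calc volume starE ≤ volume ((⋃ k, piece k) ∪ (starE \ ⋃ k, piece k)) := by
          apply measure_mono
          intro p hp
          by_cases h : p ∈ ⋃ k, piece k
          · exact Or.inl h
          · exact Or.inr ⟨hp, h⟩
      _ ≤ volume (⋃ k, piece k) + volume (starE \ ⋃ k, piece k) := measure_union_le _ _
      _ ≤ volume (⋃ k, piece k) + volume (⋃ j, ⋃ k, ⋃ (_ : j ≠ k), tie j k : Set X) := by
          gcongr
          exact starE_diff_subset
      _ = volume (⋃ k, piece k) := by rw [volume_ties, add_zero]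
  · exact measure_mono (iUnion_subset piece_subset)

/-! ### the piece where `‖a‖` is maximal: scaling and rotation -/

/-- lens-pair set attached to a vector `u` (unit in applications) [folklore] -/
def lensPair (u : E) : Set (E × E) :=
  {y | ‖y.1‖ < 1 ∧ ‖y.2‖ < 1 ∧ dist u y.1 < 1 ∧ dist u y.2 < 1 ∧ dist y.1 y.2 < 1}

/-- the `(b,c)`-section of `piece 0` over `a` [folklore] -/
def sectA (a : E) : Set (E × E) :=
  {y | ‖y.1‖ < ‖a‖ ∧ ‖y.2‖ < ‖a‖ ∧ dist a y.1 < ‖a‖ ∧ dist a y.2 < ‖a‖ ∧ dist y.1 y.2 < ‖a‖}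

/-- `lensPair u` is measurable. [folklore] -/
theorem measurableSet_lensPair (u : E) : MeasurableSet (lensPair u) := by
  have : lensPair u = {y : E × E | ‖y.1‖ < 1} ∩ {y | ‖y.2‖ < 1} ∩ {y | dist u y.1 < 1} ∩
      {y | dist u y.2 < 1} ∩ {y | dist y.1 y.2 < 1} := by
    ext y; simp only [lensPair, mem_setOf_eq, mem_inter_iff]; tauto
  rw [this]
  refine (((measurableSet_lt (by fun_prop : Measurable fun y : E × E => ‖y.1‖) measurable_const).inter
    (measurableSet_lt (by fun_prop : Measurable fun y : E × E => ‖y.2‖) measurable_const)).inter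
    (measurableSet_lt (by fun_prop : Measurable fun y : E × E => dist u y.1) measurable_const)).inter
    (measurableSet_lt (by fun_prop : Measurable fun y : E × E => dist u y.2) measurable_const) |>.inter
    (measurableSet_lt (by fun_prop : Measurable fun y : E × E => dist y.1 y.2) measurable_const)

/-- `piece 0` written through its sections. [folklore] -/
theorem piece_zero_eq : piece 0 = {p : X | ‖p.1‖ < 1 ∧ p.2 ∈ sectA p.1} := by
  ext ⟨a, b, c⟩
  simp only [piece, mem_setOf_eq, sectA]
  constructor
  · rintro ⟨h1, h2⟩
    refine ⟨by simpa using h1 0, ?_, ?_, ?_, ?_, ?_⟩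
    · simpa using h2 1 (by decide)
    · simpa using h2 2 (by decide)
    · simpa using h2 3 (by decide)
    · simpa using h2 4 (by decide)
    · simpa using h2 5 (by decide)
  · rintro ⟨h0, h1, h2, h3, h4, h5⟩
    refine ⟨fun j => ?_, fun j hj => ?_⟩
    · fin_cases j <;> simp <;> linarith
    · fin_cases j <;> simp at hj ⊢ <;> assumption

/-- The `a`-slice of `piece 0`. [folklore] -/
theorem slice_piece_zero (a : E) :
    Prod.mk a ⁻¹' piece 0 = if ‖a‖ < 1 then sectA a else ∅ := by
  rw [piece_zero_eq]
  ext y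
  split_ifs with h <;> simp [h]

/-- scaling: the section over `a ≠ 0` is `‖a‖ •` the lens pair of the unit vector `a/‖a‖` [folklore] -/
theorem sectA_eq_smul {a : E} (ha : a ≠ 0) :
    sectA a = ‖a‖ • lensPair (‖a‖⁻¹ • a) := by
  have hr : 0 < ‖a‖ := norm_pos_iff.mpr ha
  ext y
  rw [Set.mem_smul_set_iff_inv_smul_mem₀ hr.ne']
  simp only [sectA, lensPair, mem_setOf_eq, Prod.smul_fst, Prod.smul_snd, norm_smul, norm_inv,
    norm_norm, dist_smul₀]
  rw [inv_mul_lt_iff₀ hr, inv_mul_lt_iff₀ hr, inv_mul_lt_iff₀ hr, inv_mul_lt_iff₀ hr,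
    inv_mul_lt_iff₀ hr, mul_one]

/-- `dim (E × E) = 6`. [folklore] -/
theorem finrank_EE : Module.finrank ℝ (E × E) = 6 := by
  rw [Module.finrank_prod, finrank_euclideanSpace_fin]

/-- Lebesgue measure on `E × E` is an additive Haar measure. [folklore] -/
theorem isAddHaar_volume_EE : (volume : Measure (E × E)).IsAddHaarMeasure := by
  rw [Measure.volume_eq_prod]; infer_instance

/-- `vol(sectA a) = ‖a‖⁶ · vol(lensPair (a/‖a‖))` for `a ≠ 0`. [folklore] -/
theorem volume_sectA_of_ne {a : E} (ha : a ≠ 0) :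
    volume (sectA a) = ENNReal.ofReal (‖a‖ ^ 6) * volume (lensPair (‖a‖⁻¹ • a)) := by
  haveI := isAddHaar_volume_EE
  rw [sectA_eq_smul ha, Measure.addHaar_smul_of_nonneg volume (norm_nonneg a), finrank_EE]

/-- rotation invariance of the lens-pair volume [folklore] -/
theorem volume_lensPair_eq {u : E} (hu : ‖u‖ = 1) : volume (lensPair u) = volume (lensPair e0) := by
  have hw : ‖u‖ = ‖e0‖ := by rw [hu, norm_e0]
  have hR := Submodule.reflection_sub hw
  set R := (ℝ ∙ (u - e0))ᗮ.reflection with hRdef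
  have hmp : MeasurePreserving (fun y : E × E => (R y.1, R y.2)) volume volume :=
    R.measurePreserving.prod R.measurePreserving
  have hset : lensPair u = (fun y : E × E => (R y.1, R y.2)) ⁻¹' lensPair e0 := by
    ext y
    simp only [lensPair, mem_setOf_eq, mem_preimage, LinearIsometryEquiv.norm_map, ← hR,
      LinearIsometryEquiv.dist_map]
  rw [hset, hmp.measure_preimage (measurableSet_lensPair e0).nullMeasurableSet]

/-- `vol(sectA a) = ‖a‖⁶ · vol(lensPair e0)`. [folklore] -/
theorem volume_sectA (a : E) :
    volume (sectA a) = ENNReal.ofReal (‖a‖ ^ 6) * volume (lensPair e0) := by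
  by_cases ha : a = 0
  · subst ha
    have : sectA (0 : E) = ∅ := by
      ext y
      simp only [sectA, norm_zero, mem_setOf_eq, mem_empty_iff_false, iff_false, not_and]
      intro h; exact absurd h (not_lt.mpr (norm_nonneg _))
    rw [this, measure_empty, norm_zero]
    simp
  · rw [volume_sectA_of_ne ha, volume_lensPair_eq]
    rw [norm_smul, norm_inv, norm_norm, inv_mul_cancel₀ (norm_ne_zero_iff.mpr ha)]

/-- `vol(piece 0) = (∫_{‖a‖<1} ‖a‖⁶ da) · vol(lensPair e0)`. [folklore] -/
theorem volume_piece_zero_eq_lintegral :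
    volume (piece 0) = (∫⁻ a : E, (ball (0 : E) 1).indicator (fun a => ENNReal.ofReal (‖a‖ ^ 6)) a) *
      volume (lensPair e0) := by
  rw [Measure.volume_eq_prod, Measure.prod_apply (measurableSet_piece 0), ← lintegral_mul_const' _ _
    (measure_ne_top_of_subset ?sub ?fin)]
  case sub => exact fun y hy => show y ∈ ball (0 : E) 1 ×ˢ ball (0 : E) 1 from
    ⟨mem_ball_zero_iff.mpr hy.1, mem_ball_zero_iff.mpr hy.2.1⟩
  case fin =>
    rw [Measure.volume_eq_prod, Measure.prod_prod]
    exact ENNReal.mul_ne_top measure_ball_lt_top.ne measure_ball_lt_top.ne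
  congr 1
  ext a
  rw [slice_piece_zero]
  by_cases ha : ‖a‖ < 1
  · rw [if_pos ha, indicator_of_mem (mem_ball_zero_iff.mpr ha), volume_sectA]
  · rw [if_neg ha, indicator_of_notMem (fun h => ha (mem_ball_zero_iff.mp h)), measure_empty, zero_mul]


/-! ### the radial integral `∫_{‖a‖<1} ‖a‖⁶ da = 4π/9` -/

/-- `∫_{‖a‖<1} ‖a‖⁶ da = 4π/9`. [folklore] -/
theorem lintegral_ball_norm_pow_six :
    ∫⁻ a : E, (ball (0 : E) 1).indicator (fun a => ENNReal.ofReal (‖a‖ ^ 6)) a =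
      ENNReal.ofReal (4 * π / 9) := by
  have h1 : ∀ a : E, (ball (0 : E) 1).indicator (fun a => ENNReal.ofReal (‖a‖ ^ 6)) a =
      ENNReal.ofReal ((fun y => (Iio 1).indicator (fun y => y ^ 6) y) ‖a‖) := by
    intro a
    by_cases ha : a ∈ ball (0 : E) 1
    · have ha' : ‖a‖ ∈ Iio (1 : ℝ) := by simpa using ha
      simp only [indicator_of_mem ha, indicator_of_mem ha']
    · have ha' : ‖a‖ ∉ Iio (1 : ℝ) := by simpa using ha
      simp only [indicator_of_notMem ha, indicator_of_notMem ha', ENNReal.ofReal_zero]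
  simp_rw [h1]
  have hint : Integrable fun a : E => (fun y => (Iio 1).indicator (fun y => y ^ 6) y) ‖a‖ := by
    have : (fun a : E => (fun y => (Iio 1).indicator (fun y => y ^ 6) y) ‖a‖) =
        (ball (0 : E) 1).indicator fun a => ‖a‖ ^ 6 := by
      ext a
      by_cases ha : a ∈ ball (0 : E) 1
      · have ha' : ‖a‖ ∈ Iio (1 : ℝ) := by simpa using ha
        simp only [indicator_of_mem ha, indicator_of_mem ha']
      · have ha' : ‖a‖ ∉ Iio (1 : ℝ) := by simpa using ha
        simp only [indicator_of_notMem ha, indicator_of_notMem ha']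
    rw [this, integrable_indicator_iff measurableSet_ball]
    exact ((by fun_prop : Continuous fun a : E => ‖a‖ ^ 6).continuousOn.integrableOn_compact
      (isCompact_closedBall (0 : E) 1)).mono_set ball_subset_closedBall
  rw [← ofReal_integral_eq_lintegral_ofReal hint (ae_of_all _ fun a => ?_)]
  swap
  · simp only
    by_cases ha : ‖a‖ ∈ Iio (1 : ℝ)
    · simp only [indicator_of_mem ha]; positivity
    · simp only [indicator_of_notMem ha]; exact le_rfl
  congr 1
  rw [integral_norm_E]
  have h2 : ∀ y : ℝ, y ^ 2 * (Iio 1).indicator (fun y => y ^ 6) y =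
      (Iio 1).indicator (fun y => y ^ 8) y := by
    intro y
    by_cases hy : y ∈ Iio (1 : ℝ)
    · simp only [indicator_of_mem hy]; ring
    · simp only [indicator_of_notMem hy, mul_zero]
  simp_rw [h2]
  rw [setIntegral_indicator measurableSet_Iio, Ioi_inter_Iio, ← integral_Ioc_eq_integral_Ioo,
    ← intervalIntegral.integral_of_le zero_le_one, integral_pow]
  norm_num
  ring

/-- **Two-centre reduction of the complete star** (Lyberg 2005 §2 display (13), `[complete star] = −4 B₂ χ(1)` with `B₂ = 2π/3` and `χ(1) = −vol(lensPair e0)` for hard spheres): `vol(starE) = (8π/3) · vol(lensPair e0)`. Proved here by symmetry + scaling instead of the `σ`-derivative. [folklore] -/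
theorem volume_starE : volume starE = ENNReal.ofReal (8 * π / 3) * volume (lensPair e0) := by
  rw [volume_starE_eq, volume_piece_zero_eq_lintegral, lintegral_ball_norm_pow_six, ← mul_assoc]
  congr 1
  rw [show (6 : ENNReal) = ENNReal.ofReal 6 by simp, ← ENNReal.ofReal_mul (by norm_num)]
  congr 1
  ring


/-- The fact's complete-star set is the `cfg`-preimage of the literal block-form star set.
[folklore] -/
theorem star_eq_preimage : hardSphereStarFour = cfg ⁻¹'
    {p : X | ‖p.1‖ < 1 ∧ ‖p.2.1‖ < 1 ∧ ‖p.2.2‖ < 1 ∧ dist p.1 p.2.1 < 1 ∧ dist p.1 p.2.2 < 1 ∧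
      dist p.2.1 p.2.2 < 1} := by
  ext x
  obtain ⟨h0, h1, h2, h3, h4, h5, h6, h7, h8⟩ := cfg_apply x
  simp only [hardSphereStarFour, mem_setOf_eq, mem_preimage, norm_lt_one_iff, dist_lt_one_iff,
    h0, h1, h2, h3, h4, h5, h6, h7, h8]

/-- Literal block-form star set `=` `starE`. [folklore] -/
theorem starLit_eq_starE :
    {p : X | ‖p.1‖ < 1 ∧ ‖p.2.1‖ < 1 ∧ ‖p.2.2‖ < 1 ∧ dist p.1 p.2.1 < 1 ∧ dist p.1 p.2.2 < 1 ∧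
      dist p.2.1 p.2.2 < 1} = starE := by
  ext p
  simp only [mem_setOf_eq, starE]
  constructor
  · rintro ⟨h0, h1, h2, h3, h4, h5⟩ j
    fin_cases j <;> simpa
  · intro h
    exact ⟨by simpa using h 0, by simpa using h 1, by simpa using h 2, by simpa using h 3,
      by simpa using h 4, by simpa using h 5⟩

end BoltzmannB4

/-- **The complete star of `B₄` for hard spheres in `ℝ³` reduces to the two-centre lens pair at
contact**: `vol(hardSphereStarFour) = (8π/3) · vol(lensPair e0)` — Lyberg 2005 §2 display (13),
`[complete star] = −4B₂·χ(1)` with `B₂ = 2π/3`, `χ(1) = −vol(lensPair e0)` for hard spheres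
(five `f`-bonds, `f = −𝟙`). [cite: Lyberg2005, §2 display (13)] -/
theorem volume_hardSphereStarFour_eq :
    volume hardSphereStarFour =
      ENNReal.ofReal (8 * π / 3) * volume (BoltzmannB4.lensPair BoltzmannB4.e0) := by
  rw [BoltzmannB4.star_eq_preimage, BoltzmannB4.starLit_eq_starE,
    BoltzmannB4.volume_preserving_cfg.measure_preimage
      BoltzmannB4.measurableSet_starE.nullMeasurableSet, BoltzmannB4.volume_starE]



/-! ## Part 3: cylindrical reduction of the lens pair and the disc-pair measure

Following Lyberg 2005 §3 (Nijboer–van Hove): in cylindrical coordinates about the axis `e0` the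
lens-pair volume `vol(lensPair e0)` is a double integral over the heights `z, z′` of the measure of
the planar DISC-PAIR set `DP(r₁,r₂,r₃) = {(x,x′) : |x|² < r₁, |x′|² < r₂, |x−x′|² < r₃}` with
`r₁ = R(z)² = msq z`, `r₂ = msq z′`, `r₃ = 1 − (z − z′)²` (`volume_lensPair_eq_lintegral`); the
square `(z,z′) ∈ (0,1)²` folds onto `(u,v) ∈ [1/2,1]²` (`u = max(z, 1−z)`) giving a SAME-SIDE
term `Gs` (`r₃ = 1 − (u−v)²`, Lyberg's `α(z,−z′)`) and an OPPOSITE-SIDE term `Go`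
(`r₃ = 1 − (u+v−1)²`, Lyberg's `α(z,z′)`), `lintegral_Gf_fold`, `lintegral_Sq_eq`. The disc-pair
measure is computed in closed form (`volume_DPE`, `volume_DPE_tri`, `volume_DPE_cap`): for radii
`p, q, s` in the triangle case
`M(p,q,s) = (πp²/2)·A(q,s;p) + (πq²/2)·A(p,s;q) + (πs²/2)·A(q,p;s)` with `A` the planar lens area
(`volume_lens2`, `lensArea`) — equivalently `π(q²s²A_p + p²s²A_q + p²q²A_s) − (π/4)(p²+q²+s²)√H`,
the `n = 1` case of Lyberg's Sonine–Dougall evaluation — proved here by the same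
partition-by-largest-scaled-distance + scaling argument as Part 2 (degree-4 homogeneity), and
`M = π²p²q²` when `s ≥ p + q`.
-/

namespace BoltzmannB4

local notation "E" => EuclideanSpace ℝ (Fin 3)
local notation "E2" => EuclideanSpace ℝ (Fin 2)
local notation "F2" => Fin 2 → ℝ
local notation "Y" => EuclideanSpace ℝ (Fin 2) × EuclideanSpace ℝ (Fin 2)



/-- The planar DISC-PAIR set with squared radii `r₁ r₂ r₃`, in coordinates: `|x|² < r₁`, `|x′|² < r₂`, `|x − x′|² < r₃`. [folklore] -/
def DP (r₁ r₂ r₃ : ℝ) : Set (F2 × F2) :=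
  {q | q.1 0 ^ 2 + q.1 1 ^ 2 < r₁ ∧ q.2 0 ^ 2 + q.2 1 ^ 2 < r₂ ∧
    (q.1 0 - q.2 0) ^ 2 + (q.1 1 - q.2 1) ^ 2 < r₃}

/-- `DP` is measurable. [folklore] -/
theorem measurableSet_DP (r₁ r₂ r₃ : ℝ) : MeasurableSet (DP r₁ r₂ r₃) := by
  have : DP r₁ r₂ r₃ = {q : F2 × F2 | q.1 0 ^ 2 + q.1 1 ^ 2 < r₁} ∩ {q | q.2 0 ^ 2 + q.2 1 ^ 2 < r₂} ∩
      {q | (q.1 0 - q.2 0) ^ 2 + (q.1 1 - q.2 1) ^ 2 < r₃} := by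
    ext q; simp only [DP, mem_setOf_eq, mem_inter_iff]; tauto
  rw [this]
  exact ((measurableSet_lt (by fun_prop) measurable_const).inter
    (measurableSet_lt (by fun_prop) measurable_const)).inter
    (measurableSet_lt (by fun_prop) measurable_const)

/-- Squared radius of the slice of the unit lens (poles `0`, `e0`) at height `z`: `min(1 − z², 1 − (1 − z)²)`. [folklore] -/
def msq (z : ℝ) : ℝ := min (1 - z ^ 2) (1 - (1 - z) ^ 2)

/-- Cylindrical coordinates on `E`: `b ↦ (b₀, (b₁, b₂))`. [folklore] -/
def ψ₁ : E ≃ᵐ ℝ × F2 :=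
  (MeasurableEquiv.toLp 2 (Fin 3 → ℝ)).symm.trans (MeasurableEquiv.piFinSuccAbove (fun _ => ℝ) 0)

/-- `ψ₁` preserves volume. [folklore] -/
theorem volume_preserving_ψ₁ : MeasurePreserving ψ₁ volume volume :=
  (EuclideanSpace.volume_preserving_symm_measurableEquiv_toLp (Fin 3)).trans
    (volume_preserving_piFinSuccAbove (fun _ : Fin 3 => ℝ) 0)

/-- Formula for `ψ₁`. [folklore] -/
theorem ψ₁_apply (b : E) : ψ₁ b = (b.ofLp 0, fun j => b.ofLp j.succ) := by
  simp [ψ₁, MeasurableEquiv.piFinSuccAbove_apply, Fin.insertNthEquiv_zero, Fin.consEquiv]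
  rfl

/-- First component of `ψ₁`. [folklore] -/
theorem ψ₁_fst (b : E) : (ψ₁ b).1 = b.ofLp 0 := by rw [ψ₁_apply]
/-- Second component of `ψ₁`, coordinate `0`. [folklore] -/
theorem ψ₁_snd0 (b : E) : (ψ₁ b).2 0 = b.ofLp 1 := by rw [ψ₁_apply]; rfl
/-- Second component of `ψ₁`, coordinate `1`. [folklore] -/
theorem ψ₁_snd1 (b : E) : (ψ₁ b).2 1 = b.ofLp 2 := by rw [ψ₁_apply]; rfl

/-- The rearrangement `(ℝ × F2) × (ℝ × F2) ≃ᵐ (ℝ × ℝ) × (F2 × F2)`. [folklore] -/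
def rearr : (ℝ × F2) × (ℝ × F2) ≃ᵐ (ℝ × ℝ) × (F2 × F2) :=
  MeasurableEquiv.prodAssoc.trans <|
    (MeasurableEquiv.prodCongr (MeasurableEquiv.refl ℝ)
      (MeasurableEquiv.prodAssoc.symm.trans
        ((MeasurableEquiv.prodCongr MeasurableEquiv.prodComm (MeasurableEquiv.refl F2)).trans
          MeasurableEquiv.prodAssoc))).trans
    MeasurableEquiv.prodAssoc.symm

/-- Formula for `rearr`. [folklore] -/
theorem rearr_apply (p : (ℝ × F2) × (ℝ × F2)) : rearr p = ((p.1.1, p.2.1), (p.1.2, p.2.2)) := rfl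

/-- `rearr` preserves volume. [folklore] -/
theorem volume_preserving_rearr : MeasurePreserving rearr volume volume := by
  have hA1 : MeasurePreserving (fun p : (ℝ × F2) × (ℝ × F2) => (p.1.1, (p.1.2, p.2)))
      volume volume := by
    have := measurePreserving_prodAssoc (volume : Measure ℝ) (volume : Measure F2)
      (volume : Measure (ℝ × F2))
    simpa [Measure.volume_eq_prod, MeasurableEquiv.prodAssoc, Equiv.prodAssoc] using this
  have hA2s : MeasurePreserving (fun p : F2 × (ℝ × F2) => ((p.1, p.2.1), p.2.2))
      volume volume := by
    have := (measurePreserving_prodAssoc (volume : Measure F2) (volume : Measure ℝ)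
      (volume : Measure F2)).symm
    simpa [Measure.volume_eq_prod, MeasurableEquiv.prodAssoc, Equiv.prodAssoc] using this
  have hA3s : MeasurePreserving (fun p : ℝ × (ℝ × (F2 × F2)) => ((p.1, p.2.1), p.2.2))
      volume volume := by
    have := (measurePreserving_prodAssoc (volume : Measure ℝ) (volume : Measure ℝ)
      (volume : Measure (F2 × F2))).symm
    simpa [Measure.volume_eq_prod, MeasurableEquiv.prodAssoc, Equiv.prodAssoc] using this
  have hA4 : MeasurePreserving (fun p : (ℝ × F2) × F2 => (p.1.1, (p.1.2, p.2)))
      volume volume := by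
    have := measurePreserving_prodAssoc (volume : Measure ℝ) (volume : Measure F2)
      (volume : Measure F2)
    simpa [Measure.volume_eq_prod, MeasurableEquiv.prodAssoc, Equiv.prodAssoc] using this
  have hC : MeasurePreserving (Prod.swap : F2 × ℝ → ℝ × F2) volume volume := by
    have := Measure.measurePreserving_swap (μ := (volume : Measure F2)) (ν := (volume : Measure ℝ))
    simpa [Measure.volume_eq_prod] using this
  have hinner : MeasurePreserving (fun p : F2 × (ℝ × F2) => (p.2.1, (p.1, p.2.2))) volume volume := by
    have h := (hA4.comp (hC.prod (MeasurePreserving.id (volume : Measure F2)))).comp hA2s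
    exact h
  have h := (hA3s.comp ((MeasurePreserving.id (volume : Measure ℝ)).prod hinner)).comp hA1
  exact h

/-- Cylindrical coordinates on `E × E`: `(b, c) ↦ ((b₀, c₀), ((b₁,b₂), (c₁,c₂)))`. [folklore] -/
def Ψ : E × E ≃ᵐ (ℝ × ℝ) × (F2 × F2) := (MeasurableEquiv.prodCongr ψ₁ ψ₁).trans rearr

/-- `Ψ` preserves volume. [folklore] -/
theorem volume_preserving_Ψ : MeasurePreserving Ψ volume volume :=
  (volume_preserving_ψ₁.prod volume_preserving_ψ₁).trans volume_preserving_rearr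

/-- Formula for `Ψ`. [folklore] -/
theorem Ψ_apply (y : E × E) :
    Ψ y = ((y.1.ofLp 0, y.2.ofLp 0), ((ψ₁ y.1).2, (ψ₁ y.2).2)) := by
  simp only [Ψ, MeasurableEquiv.trans_apply, MeasurableEquiv.prodCongr, rearr_apply]
  simp [ψ₁_fst]

/-- The lens-pair set in cylindrical coordinates. [folklore] -/
def cylSet : Set ((ℝ × ℝ) × (F2 × F2)) :=
  {q | q.2 ∈ DP (msq q.1.1) (msq q.1.2) (1 - (q.1.1 - q.1.2) ^ 2)}

/-- `lensPair e0` is the `Ψ`-preimage of `cylSet`. [folklore] -/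
theorem lensPair_eq_preimage : lensPair e0 = Ψ ⁻¹' cylSet := by
  ext y
  simp only [lensPair, mem_setOf_eq, mem_preimage, cylSet, DP, msq, Ψ_apply, ψ₁_snd0, ψ₁_snd1,
    norm_lt_one_iff, dist_lt_one_iff, e0_apply, lt_min_iff]
  simp only [Fin.isValue, ↓reduceIte, one_ne_zero, Fin.reduceEq, zero_sub, even_two, Even.neg_pow]
  constructor
  · rintro ⟨h1, h2, h3, h4, h5⟩
    refine ⟨⟨by linarith, by nlinarith⟩, ⟨by linarith, by nlinarith⟩, by nlinarith⟩
  · rintro ⟨⟨h1, h2⟩, ⟨h3, h4⟩, h5⟩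
    refine ⟨by linarith, by linarith, by nlinarith, by nlinarith, by nlinarith⟩

/-- `cylSet` is measurable. [folklore] -/
theorem measurableSet_cylSet : MeasurableSet cylSet := by
  have : cylSet = {q : (ℝ × ℝ) × (F2 × F2) | q.2.1 0 ^ 2 + q.2.1 1 ^ 2 < msq q.1.1} ∩
      {q | q.2.2 0 ^ 2 + q.2.2 1 ^ 2 < msq q.1.2} ∩
      {q | (q.2.1 0 - q.2.2 0) ^ 2 + (q.2.1 1 - q.2.2 1) ^ 2 < 1 - (q.1.1 - q.1.2) ^ 2} := by
    ext q; simp only [cylSet, DP, mem_setOf_eq, mem_inter_iff]; tauto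
  rw [this]
  have hm : Measurable msq := by unfold msq; fun_prop
  exact ((measurableSet_lt (by fun_prop) (hm.comp (by fun_prop))).inter
    (measurableSet_lt (by fun_prop) (hm.comp (by fun_prop)))).inter
    (measurableSet_lt (by fun_prop) (by fun_prop))

/-- **Cylindrical reduction** (Lyberg 2005 §3: integrate the horizontal variables first): `vol(lensPair e0) = ∫∫ vol(DP(R(z)², R(z′)², 1 − (z − z′)²)) dz dz′`. [folklore] -/
theorem volume_lensPair_eq_lintegral :
    volume (lensPair e0) =
      ∫⁻ zz : ℝ × ℝ, volume (DP (msq zz.1) (msq zz.2) (1 - (zz.1 - zz.2) ^ 2)) := by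
  rw [lensPair_eq_preimage, volume_preserving_Ψ.measure_preimage measurableSet_cylSet.nullMeasurableSet,
    Measure.volume_eq_prod, Measure.prod_apply measurableSet_cylSet]
  rfl





/-- `vol{y : ℝ | y² < m} = 2√m` (`= 0` for `m ≤ 0`). [folklore] -/
theorem volume_sq_lt (m : ℝ) : volume {y : ℝ | y ^ 2 < m} = ENNReal.ofReal (2 * Real.sqrt m) := by
  rcases le_or_gt m 0 with hm | hm
  · have : {y : ℝ | y ^ 2 < m} = ∅ := by
      ext y; simp only [mem_setOf_eq, mem_empty_iff_false, iff_false, not_lt]; nlinarith [sq_nonneg y]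
    rw [this, measure_empty, Real.sqrt_eq_zero'.mpr hm, mul_zero, ENNReal.ofReal_zero]
  · have : {y : ℝ | y ^ 2 < m} = Ioo (-Real.sqrt m) (Real.sqrt m) := by
      ext y
      rw [mem_setOf_eq, mem_Ioo, ← abs_lt, ← Real.sqrt_lt_sqrt_iff (sq_nonneg y) , Real.sqrt_sq_eq_abs]
    rw [this, Real.volume_Ioo]
    congr 1; ring

/-- The unit vector along the first axis of the plane. [folklore] -/
def ex : E2 := EuclideanSpace.single (0 : Fin 2) (1 : ℝ)

/-- Coordinates of `ex`. [folklore] -/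
theorem ex_apply (i : Fin 2) : ex.ofLp i = if i = 0 then 1 else 0 := by simp [ex]

/-- `‖ex‖ = 1`. [folklore] -/
theorem norm_ex : ‖ex‖ = 1 := by simp [ex]

/-- `|y| < a` in coordinates. [folklore] -/
theorem mem_ball_zero_iff_coord2 (y : E2) (a : ℝ) (ha : 0 < a) :
    y ∈ ball (0 : E2) a ↔ y.ofLp 0 ^ 2 + y.ofLp 1 ^ 2 < a ^ 2 := by
  rw [mem_ball_zero_iff, EuclideanSpace.norm_eq]
  simp only [Real.norm_eq_abs, sq_abs, Fin.sum_univ_two]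
  rw [Real.sqrt_lt' ha]

/-- `|y − d·ex| < b` in coordinates. [folklore] -/
theorem mem_ball_axis_iff_coord2 (y : E2) (d b : ℝ) (hb : 0 < b) :
    y ∈ ball (d • ex) b ↔ (y.ofLp 0 - d) ^ 2 + y.ofLp 1 ^ 2 < b ^ 2 := by
  rw [mem_ball, EuclideanSpace.dist_eq]
  simp only [Fin.sum_univ_two, Real.dist_eq, sq_abs]
  rw [Real.sqrt_lt' hb]
  simp [ex_apply]

/-- Slicing the planar lens perpendicular to its axis: `area = ∫ 2√(min(a² − t², b² − (t − d)²))⁺ dt`. [folklore] -/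
theorem volume_lens2_eq_lintegral {a b : ℝ} (ha : 0 < a) (hb : 0 < b) (d : ℝ) :
    volume (ball (0 : E2) a ∩ ball (d • ex) b) =
      ∫⁻ t : ℝ, ENNReal.ofReal (2 * Real.sqrt (min (a ^ 2 - t ^ 2) (b ^ 2 - (t - d) ^ 2))) := by
  have h1 : ball (0 : E2) a ∩ ball (d • ex) b = (MeasurableEquiv.toLp 2 (Fin 2 → ℝ)).symm ⁻¹'
      {y : Fin 2 → ℝ | (y 0 - 0) ^ 2 + y 1 ^ 2 < a ^ 2 ∧ (y 0 - d) ^ 2 + y 1 ^ 2 < b ^ 2} := by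
    ext y
    simp only [mem_inter_iff, mem_preimage, mem_setOf_eq, mem_ball_zero_iff_coord2 y a ha,
      mem_ball_axis_iff_coord2 y d b hb, sub_zero]
    rfl
  have hmeas : ∀ c : ℝ, Measurable fun y : Fin 2 → ℝ => (y 0 - c) ^ 2 + y 1 ^ 2 := fun c => by
    fun_prop
  have hSm : MeasurableSet {y : Fin 2 → ℝ | (y 0 - 0) ^ 2 + y 1 ^ 2 < a ^ 2 ∧
      (y 0 - d) ^ 2 + y 1 ^ 2 < b ^ 2} :=
    (measurableSet_lt (hmeas 0) measurable_const).inter (measurableSet_lt (hmeas d) measurable_const)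
  rw [h1, (EuclideanSpace.volume_preserving_symm_measurableEquiv_toLp (Fin 2)).measure_preimage
    hSm.nullMeasurableSet]
  have hPm : MeasurableSet {p : ℝ × ℝ | p.2 ^ 2 < min (a ^ 2 - p.1 ^ 2) (b ^ 2 - (p.1 - d) ^ 2)} :=
    measurableSet_lt (by fun_prop) (by fun_prop)
  have h2 : {y : Fin 2 → ℝ | (y 0 - 0) ^ 2 + y 1 ^ 2 < a ^ 2 ∧ (y 0 - d) ^ 2 + y 1 ^ 2 < b ^ 2} =
      MeasurableEquiv.finTwoArrow ⁻¹'
        {p : ℝ × ℝ | p.2 ^ 2 < min (a ^ 2 - p.1 ^ 2) (b ^ 2 - (p.1 - d) ^ 2)} := by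
    ext y
    simp only [mem_setOf_eq, mem_preimage, MeasurableEquiv.finTwoArrow_apply, lt_min_iff, sub_zero]
    constructor <;> rintro ⟨h1, h2⟩ <;> constructor <;> linarith
  rw [h2, (volume_preserving_finTwoArrow ℝ).measure_preimage hPm.nullMeasurableSet,
    Measure.volume_eq_prod, Measure.prod_apply hPm]
  congr 1
  ext t
  have : Prod.mk t ⁻¹' {p : ℝ × ℝ | p.2 ^ 2 < min (a ^ 2 - p.1 ^ 2) (b ^ 2 - (p.1 - d) ^ 2)} =
      {y : ℝ | y ^ 2 < min (a ^ 2 - t ^ 2) (b ^ 2 - (t - d) ^ 2)} := by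
    ext y; simp
  rw [this, volume_sq_lt]

/-- Antiderivative of `2√(r² − (t − c)²)`: `(t−c)√(r²−(t−c)²) + r² arcsin((t−c)/r)`. [folklore] -/
def segA (r c t : ℝ) : ℝ := (t - c) * Real.sqrt (r ^ 2 - (t - c) ^ 2) + r ^ 2 * Real.arcsin ((t - c) / r)

/-- `segA′ = 2√(r² − (t−c)²)` inside the interval. [folklore] -/
theorem hasDerivAt_segA {r c t : ℝ} (hr : 0 < r) (ht : (t - c) ^ 2 < r ^ 2) :
    HasDerivAt (segA r c) (2 * Real.sqrt (r ^ 2 - (t - c) ^ 2)) t := by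
  have hpos : 0 < r ^ 2 - (t - c) ^ 2 := by linarith
  have hsq : Real.sqrt (r ^ 2 - (t - c) ^ 2) ^ 2 = r ^ 2 - (t - c) ^ 2 := Real.sq_sqrt hpos.le
  have hsqpos : 0 < Real.sqrt (r ^ 2 - (t - c) ^ 2) := Real.sqrt_pos.mpr hpos
  -- derivative of the sqrt part
  have h1 : HasDerivAt (fun t => r ^ 2 - (t - c) ^ 2) (-(2 * (t - c))) t := by
    have := (((hasDerivAt_id t).sub_const c).pow 2).const_sub (r ^ 2)
    exact this.congr_deriv (by simp)
  have h2 : HasDerivAt (fun t => Real.sqrt (r ^ 2 - (t - c) ^ 2))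
      (-(2 * (t - c)) / (2 * Real.sqrt (r ^ 2 - (t - c) ^ 2))) t := h1.sqrt hpos.ne'
  have h3 : HasDerivAt (fun t => (t - c) * Real.sqrt (r ^ 2 - (t - c) ^ 2))
      (1 * Real.sqrt (r ^ 2 - (t - c) ^ 2) +
        (t - c) * (-(2 * (t - c)) / (2 * Real.sqrt (r ^ 2 - (t - c) ^ 2)))) t :=
    ((hasDerivAt_id t).sub_const c).mul h2
  -- arcsin part
  have habs : |t - c| < r := abs_lt.mpr ⟨by nlinarith, by nlinarith⟩
  have hlt : |(t - c) / r| < 1 := by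
    rw [abs_div, abs_of_pos hr, div_lt_one hr]; exact habs
  have hne1 : (t - c) / r ≠ -1 := fun h => by rw [h] at hlt; norm_num at hlt
  have hne2 : (t - c) / r ≠ 1 := fun h => by rw [h] at hlt; norm_num at hlt
  have h4 : HasDerivAt (fun t => Real.arcsin ((t - c) / r))
      (1 / Real.sqrt (1 - ((t - c) / r) ^ 2) * (1 / r)) t := by
    have := (Real.hasDerivAt_arcsin hne1 hne2).comp t (((hasDerivAt_id t).sub_const c).div_const r)
    exact this.congr_deriv (by simp)
  have hsqrt_eq : Real.sqrt (1 - ((t - c) / r) ^ 2) = Real.sqrt (r ^ 2 - (t - c) ^ 2) / r := by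
    have : 1 - ((t - c) / r) ^ 2 = (r ^ 2 - (t - c) ^ 2) / r ^ 2 := by
      field_simp
    rw [this, Real.sqrt_div hpos.le, Real.sqrt_sq hr.le]
  have h5 := h3.add (h4.const_mul (r ^ 2))
  have hfun : (fun t => (t - c) * Real.sqrt (r ^ 2 - (t - c) ^ 2)) +
      (fun t => r ^ 2 * Real.arcsin ((t - c) / r)) = segA r c := by
    funext x; simp [segA]
  rw [hfun] at h5
  refine h5.congr_deriv ?_
  rw [hsqrt_eq]
  set S := Real.sqrt (r ^ 2 - (t - c) ^ 2) with hS
  field_simp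
  nlinarith [hsq]

/-- `segA` is continuous. [folklore] -/
theorem continuous_segA {r c : ℝ} : Continuous (segA r c) := by
  unfold segA; fun_prop

/-- `∫_{x₁}^{x₂} 2√(r² − (t−c)²) dt = segA x₂ − segA x₁` on `[c − r, c + r]`. [folklore] -/
theorem integral_two_sqrt {r c x₁ x₂ : ℝ} (hr : 0 < r) (h1 : c - r ≤ x₁) (h12 : x₁ ≤ x₂) (h2 : x₂ ≤ c + r) :
    ∫ t in x₁..x₂, 2 * Real.sqrt (r ^ 2 - (t - c) ^ 2) = segA r c x₂ - segA r c x₁ := by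
  apply integral_eq_sub_of_hasDerivAt_of_le h12 continuous_segA.continuousOn
  · intro t ht
    apply hasDerivAt_segA hr
    have : |t - c| < r := abs_lt.mpr ⟨by linarith [ht.1], by linarith [ht.2]⟩
    calc (t - c) ^ 2 = |t - c| ^ 2 := (sq_abs _).symm
      _ < r ^ 2 := by gcongr
  · exact ((by fun_prop : Continuous fun t => 2 * Real.sqrt (r ^ 2 - (t - c) ^ 2))).intervalIntegrable _ _


/-- Abscissa of the radical line of two circles (radii `a`, `b`, centre distance `d`): `(d² + a² − b²)/(2d)`. [folklore] -/
def t0 (a b d : ℝ) : ℝ := (d ^ 2 + a ^ 2 - b ^ 2) / (2 * d)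

/-- **Planar lens area** `a² arccos((d²+a²−b²)/(2da)) + b² arccos((d²+b²−a²)/(2db)) − d·√(a² − t0²)` (the classical formula; `d√(a²−t0²) = ½√((−d+a+b)(d+a−b)(d−a+b)(d+a+b))`). [folklore] -/
def lensArea (a b d : ℝ) : ℝ :=
  a ^ 2 * Real.arccos ((d ^ 2 + a ^ 2 - b ^ 2) / (2 * d * a)) +
    b ^ 2 * Real.arccos ((d ^ 2 + b ^ 2 - a ^ 2) / (2 * d * b)) -
    d * Real.sqrt (a ^ 2 - t0 a b d ^ 2)

/-- **Area of the planar lens** (triangle case `|a − b| < d < a + b`): `area(D(0,a) ∩ D(d·ex, b)) = lensArea a b d`. [folklore] -/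
theorem volume_lens2 {a b d : ℝ} (ha : 0 < a) (hb : 0 < b) (hd : 0 < d) (h1 : d < a + b)
    (h2 : a < d + b) (h3 : b < d + a) :
    volume (ball (0 : E2) a ∩ ball (d • ex) b) = ENNReal.ofReal (lensArea a b d) := by
  rw [volume_lens2_eq_lintegral ha hb d]
  set f : ℝ → ℝ := fun t => 2 * Real.sqrt (min (a ^ 2 - t ^ 2) (b ^ 2 - (t - d) ^ 2)) with hf
  have hfc : Continuous f := by simp only [hf]; fun_prop
  have hfnn : ∀ t, 0 ≤ f t := fun t => by simp only [hf]; positivity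
  -- support
  have hind : (fun t => ENNReal.ofReal (f t)) = (Ioc (d - b) a).indicator fun t => ENNReal.ofReal (f t) := by
    ext t
    by_cases ht : t ∈ Ioc (d - b) a
    · simp [ht]
    · rw [indicator_of_notMem ht]
      simp only [mem_Ioc, not_and_or, not_lt, not_le] at ht
      have : min (a ^ 2 - t ^ 2) (b ^ 2 - (t - d) ^ 2) ≤ 0 := by
        rcases ht with ht | ht
        · exact le_trans (min_le_right _ _) (by nlinarith)
        · exact le_trans (min_le_left _ _) (by nlinarith)
      simp only [hf, Real.sqrt_eq_zero'.mpr this, mul_zero, ENNReal.ofReal_zero]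
  change ∫⁻ t, ENNReal.ofReal (f t) = _
  have hdb : d - b ≤ a := by linarith
  rw [hind, lintegral_indicator measurableSet_Ioc,
    ← ofReal_integral_eq_lintegral_ofReal (hfc.integrableOn_Icc.mono_set Ioc_subset_Icc_self)
      (ae_of_all _ hfnn), ← integral_of_le hdb]
  -- split at t0
  set τ := t0 a b d with hτ
  have hτ1 : d - b < τ := by
    simp only [hτ, t0]; rw [lt_div_iff₀ (by linarith)]; nlinarith
  have hτ2 : τ < a := by
    simp only [hτ, t0]; rw [div_lt_iff₀ (by linarith)]; nlinarith
  have hτ3 : -a < τ := by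
    simp only [hτ, t0]; rw [lt_div_iff₀ (by linarith)]; nlinarith
  have hτ4 : τ < d + b := by linarith
  have key : 2 * d * τ = d ^ 2 + a ^ 2 - b ^ 2 := by
    simp only [hτ, t0]; field_simp
  rw [← integral_add_adjacent_intervals (b := τ) (hfc.intervalIntegrable _ _) (hfc.intervalIntegrable _ _)]
  have hleft : ∫ t in (d - b)..τ, f t = ∫ t in (d - b)..τ, 2 * Real.sqrt (b ^ 2 - (t - d) ^ 2) := by
    apply integral_congr; intro t ht
    rw [uIcc_of_le hτ1.le] at ht
    simp only [hf]
    rw [min_eq_right]; nlinarith [ht.2]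
  have hright : ∫ t in τ..a, f t = ∫ t in τ..a, 2 * Real.sqrt (a ^ 2 - (t - 0) ^ 2) := by
    apply integral_congr; intro t ht
    rw [uIcc_of_le hτ2.le] at ht
    simp only [hf, sub_zero]
    rw [min_eq_left]; nlinarith [ht.1]
  rw [hleft, hright, integral_two_sqrt hb le_rfl hτ1.le hτ4.le,
    integral_two_sqrt ha (by linarith) hτ2.le (by linarith)]
  congr 1
  -- evaluate the antiderivatives
  have hchord : b ^ 2 - (τ - d) ^ 2 = a ^ 2 - τ ^ 2 := by nlinarith [key]
  have e1 : segA a 0 a = a ^ 2 * (π / 2) := by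
    simp [segA, Real.arcsin_one, div_self ha.ne']
  have e2 : segA b d (d - b) = -(b ^ 2 * (π / 2)) := by
    have h' : d - b - d = -b := by ring
    simp only [segA, h', neg_div, div_self hb.ne', Real.arcsin_neg, Real.arcsin_one, even_two,
      Even.neg_pow, sub_self, Real.sqrt_zero, mul_zero, zero_add]
    ring
  have e3 : segA a 0 τ = τ * Real.sqrt (a ^ 2 - τ ^ 2) + a ^ 2 * Real.arcsin (τ / a) := by
    simp [segA]
  have e4 : segA b d τ = (τ - d) * Real.sqrt (a ^ 2 - τ ^ 2) + b ^ 2 * Real.arcsin ((τ - d) / b) := by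
    simp [segA, hchord]
  rw [e1, e2, e3, e4]
  simp only [lensArea, Real.arccos_eq_pi_div_two_sub_arcsin]
  have harg1 : (d ^ 2 + a ^ 2 - b ^ 2) / (2 * d * a) = τ / a := by
    rw [← key]; field_simp
  have harg2 : (d ^ 2 + b ^ 2 - a ^ 2) / (2 * d * b) = -((τ - d) / b) := by
    have : d ^ 2 + b ^ 2 - a ^ 2 = 2 * d * (d - τ) := by linarith [key]
    rw [this]; field_simp; ring
  rw [harg1, harg2, Real.arcsin_neg, ← hτ]
  ring





variable (p q s : ℝ)

/-- The three SCALED distances `(‖x‖/p, ‖x′‖/q, |x − x′|/s)` of a pair of planar points. [folklore] -/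
def dv3 (y : Y) : Fin 3 → ℝ := ![‖y.1‖ / p, ‖y.2‖ / q, dist y.1 y.2 / s]

/-- Component `0` of `dv3`. [folklore] -/
@[simp] theorem dv3_0 (y : Y) : dv3 p q s y 0 = ‖y.1‖ / p := rfl
/-- Component `1` of `dv3`. [folklore] -/
@[simp] theorem dv3_1 (y : Y) : dv3 p q s y 1 = ‖y.2‖ / q := rfl
/-- Component `2` of `dv3`. [folklore] -/
@[simp] theorem dv3_2 (y : Y) : dv3 p q s y 2 = dist y.1 y.2 / s := rfl

/-- Each scaled distance is continuous. [folklore] -/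
theorem continuous_dv3 (j : Fin 3) : Continuous fun y : Y => dv3 p q s y j := by
  fin_cases j <;> simp <;> fun_prop

/-- The disc-pair set in `E2 × E2`: all three scaled distances `< 1` (`‖x‖ < p`, `‖x′‖ < q`, `|x − x′| < s` for positive radii). [folklore] -/
def DPE : Set Y := {y | ∀ j, dv3 p q s y j < 1}

/-- The piece of `DPE` on which scaled distance `k` is the strict maximum. [folklore] -/
def piece3 (k : Fin 3) : Set Y := {y | (∀ j, dv3 p q s y j < 1) ∧ ∀ j, j ≠ k → dv3 p q s y j < dv3 p q s y k}

/-- The tie set of two scaled distances. [folklore] -/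
def tie3 (j k : Fin 3) : Set Y := {y | dv3 p q s y j = dv3 p q s y k}

/-- `DPE` is measurable. [folklore] -/
theorem measurableSet_DPE : MeasurableSet (DPE p q s) := by
  have : DPE p q s = ⋂ j, {y : Y | dv3 p q s y j < 1} := by ext y; simp [DPE]
  rw [this]
  exact MeasurableSet.iInter fun j =>
    measurableSet_lt (continuous_dv3 p q s j).measurable measurable_const

/-- `piece3 k` is measurable. [folklore] -/
theorem measurableSet_piece3 (k : Fin 3) : MeasurableSet (piece3 p q s k) := by
  have : piece3 p q s k = DPE p q s ∩ ⋂ j, {y : Y | j ≠ k → dv3 p q s y j < dv3 p q s y k} := by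
    ext y; simp [piece3, DPE]
  rw [this]
  refine (measurableSet_DPE p q s).inter (MeasurableSet.iInter fun j => ?_)
  by_cases hj : j = k
  · simp [hj]
  · simp only [hj, ne_eq, not_false_eq_true, forall_const]
    exact measurableSet_lt (continuous_dv3 p q s j).measurable (continuous_dv3 p q s k).measurable

/-- `tie3 j k` is measurable. [folklore] -/
theorem measurableSet_tie3 (j k : Fin 3) : MeasurableSet (tie3 p q s j k) :=
  measurableSet_eq_fun (continuous_dv3 p q s j).measurable (continuous_dv3 p q s k).measurable

/-- `piece3 k ⊆ DPE`. [folklore] -/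
theorem piece3_subset (k : Fin 3) : piece3 p q s k ⊆ DPE p q s := fun _ hy => hy.1

/-- The pieces are pairwise disjoint. [folklore] -/
theorem piece3_disjoint {j k : Fin 3} (h : j ≠ k) : Disjoint (piece3 p q s j) (piece3 p q s k) := by
  rw [Set.disjoint_left]
  intro y hj hk
  have h1 := hj.2 k (Ne.symm h)
  have h2 := hk.2 j h
  linarith

/-- `DPE` minus the pieces lies in the ties. [folklore] -/
theorem DPE_diff_subset :
    DPE p q s \ (⋃ k, piece3 p q s k) ⊆ ⋃ j, ⋃ k, ⋃ (_ : j ≠ k), tie3 p q s j k := by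
  intro y hy
  obtain ⟨hS, hU⟩ := hy
  simp only [mem_iUnion, not_exists] at hU ⊢
  obtain ⟨k, -, hk⟩ := Finset.exists_max_image Finset.univ (fun j => dv3 p q s y j)
    Finset.univ_nonempty
  have hk' : ∀ j, dv3 p q s y j ≤ dv3 p q s y k := fun j => hk j (Finset.mem_univ j)
  have : ¬ (∀ j, j ≠ k → dv3 p q s y j < dv3 p q s y k) := fun h => hU k ⟨hS, h⟩
  push Not at this
  obtain ⟨j, hjk, hj⟩ := this
  exact ⟨j, k, hjk, le_antisymm (hk' j) hj⟩

/-! ties are null -/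

/-- Circles are null in the plane. [folklore] -/
theorem volume_sphere_E2 (x : E2) (r : ℝ) : volume (sphere x r) = 0 :=
  Measure.addHaar_sphere volume x r

variable {p q s}

/-- The tie `‖x‖/p = ‖x′‖/q` is null (its `x`-slices are circles). [folklore] -/
theorem volume_tie3_01 (hp : 0 < p) (hq : 0 < q) : volume (tie3 p q s 0 1) = 0 := by
  rw [Measure.volume_eq_prod, Measure.prod_apply (measurableSet_tie3 p q s 0 1)]
  have : ∀ x : E2, volume (Prod.mk x ⁻¹' tie3 p q s 0 1) = 0 := by
    intro x
    have : Prod.mk x ⁻¹' tie3 p q s 0 1 = sphere (0 : E2) (q * ‖x‖ / p) := by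
      ext x'
      simp only [tie3, mem_preimage, mem_setOf_eq, dv3_0, dv3_1, mem_sphere, dist_zero_right]
      rw [div_eq_div_iff hp.ne' hq.ne', eq_div_iff hp.ne']
      constructor <;> intro h <;> linarith
    rw [this, volume_sphere_E2]
  simp_rw [this, lintegral_zero]

/-- The tie `‖x‖/p = |x−x′|/s` is null (its `x`-slices are circles). [folklore] -/
theorem volume_tie3_02 (hp : 0 < p) (hs : 0 < s) : volume (tie3 p q s 0 2) = 0 := by
  rw [Measure.volume_eq_prod, Measure.prod_apply (measurableSet_tie3 p q s 0 2)]
  have : ∀ x : E2, volume (Prod.mk x ⁻¹' tie3 p q s 0 2) = 0 := by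
    intro x
    have : Prod.mk x ⁻¹' tie3 p q s 0 2 = sphere x (s * ‖x‖ / p) := by
      ext x'
      simp only [tie3, mem_preimage, mem_setOf_eq, dv3_0, dv3_2, mem_sphere, dist_comm x' x]
      rw [div_eq_div_iff hp.ne' hs.ne', eq_div_iff hp.ne']
      constructor <;> intro h <;> linarith
    rw [this, volume_sphere_E2]
  simp_rw [this, lintegral_zero]

/-- The tie `‖x′‖/q = |x−x′|/s` is null (its `x′`-slices are circles). [folklore] -/
theorem volume_tie3_12 (hq : 0 < q) (hs : 0 < s) : volume (tie3 p q s 1 2) = 0 := by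
  rw [Measure.volume_eq_prod, Measure.prod_apply_symm (measurableSet_tie3 p q s 1 2)]
  have : ∀ x' : E2, volume ((fun x : E2 => (x, x')) ⁻¹' tie3 p q s 1 2) = 0 := by
    intro x'
    have : (fun x : E2 => (x, x')) ⁻¹' tie3 p q s 1 2 = sphere x' (s * ‖x'‖ / q) := by
      ext x
      simp only [tie3, mem_preimage, mem_setOf_eq, dv3_1, dv3_2, mem_sphere]
      rw [div_eq_div_iff hq.ne' hs.ne', eq_div_iff hq.ne']
      constructor <;> intro h <;> linarith
    rw [this, volume_sphere_E2]
  simp_rw [this, lintegral_zero]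

/-- All ties are null. [folklore] -/
theorem volume_ties3 (hp : 0 < p) (hq : 0 < q) (hs : 0 < s) :
    volume (⋃ j, ⋃ k, ⋃ (_ : j ≠ k), tie3 p q s j k : Set Y) = 0 := by
  refine measure_iUnion_null fun j => measure_iUnion_null fun k => measure_iUnion_null fun h => ?_
  have hsymm : ∀ j k, tie3 p q s j k = tie3 p q s k j := fun j k => by ext y; simp [tie3, eq_comm]
  fin_cases j <;> fin_cases k <;> simp at h
  · exact volume_tie3_01 hp hq
  · exact volume_tie3_02 hp hs
  · rw [hsymm]; exact volume_tie3_01 hp hq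
  · exact volume_tie3_12 hq hs
  · rw [hsymm]; exact volume_tie3_02 hp hs
  · rw [hsymm]; exact volume_tie3_12 hq hs

/-- `vol(DPE) = Σₖ vol(piece3 k)`. [folklore] -/
theorem volume_DPE_eq_sum (hp : 0 < p) (hq : 0 < q) (hs : 0 < s) :
    volume (DPE p q s) = volume (piece3 p q s 0) + volume (piece3 p q s 1) + volume (piece3 p q s 2) := by
  have hU : volume (⋃ k, piece3 p q s k) =
      volume (piece3 p q s 0) + volume (piece3 p q s 1) + volume (piece3 p q s 2) := by
    rw [measure_iUnion (fun j k hjk => piece3_disjoint p q s hjk) (measurableSet_piece3 p q s),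
      tsum_fintype, Fin.sum_univ_three]
  rw [← hU]
  apply le_antisymm
  · calc volume (DPE p q s) ≤ volume ((⋃ k, piece3 p q s k) ∪ (DPE p q s \ ⋃ k, piece3 p q s k)) := by
          apply measure_mono
          intro y hy
          by_cases h : y ∈ ⋃ k, piece3 p q s k
          · exact Or.inl h
          · exact Or.inr ⟨hy, h⟩
      _ ≤ volume (⋃ k, piece3 p q s k) + volume (DPE p q s \ ⋃ k, piece3 p q s k) :=
          measure_union_le _ _
      _ ≤ volume (⋃ k, piece3 p q s k) + volume (⋃ j, ⋃ k, ⋃ (_ : j ≠ k), tie3 p q s j k : Set Y) := by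
          gcongr; exact DPE_diff_subset p q s
      _ = volume (⋃ k, piece3 p q s k) := by rw [volume_ties3 hp hq hs, add_zero]
  · exact measure_mono (iUnion_subset (piece3_subset p q s))

/-! symmetries -/

/-- A map intertwining the scaled-distance vectors of two parameter triples pulls pieces back to pieces. [folklore] -/
theorem preimage_piece3 {p' q' s' : ℝ} {Φ : Y → Y} {σ : Equiv.Perm (Fin 3)}
    (h : ∀ y j, dv3 p q s (Φ y) j = dv3 p' q' s' y (σ j)) (k : Fin 3) :
    Φ ⁻¹' piece3 p q s k = piece3 p' q' s' (σ k) := by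
  ext y
  simp only [mem_preimage, piece3, mem_setOf_eq, h]
  constructor
  · rintro ⟨h1, h2⟩
    refine ⟨fun j => by simpa using h1 (σ.symm j), fun j hj => ?_⟩
    have := h2 (σ.symm j) (by intro hh; apply hj; rw [← hh]; simp)
    simpa using this
  · rintro ⟨h1, h2⟩
    exact ⟨fun j => h1 (σ j), fun j hj => h2 (σ j) (by intro hh; exact hj (σ.injective hh))⟩

/-- Swap `x ↔ x′`. [folklore] -/
def swapY (y : Y) : Y := (y.2, y.1)
/-- Shear `(x, x′) ↦ (x − x′, −x′)`. [folklore] -/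
def shearY (y : Y) : Y := (y.1 + -y.2, -y.2)

/-- The transposition `(0 1)` of `Fin 3`. [folklore] -/
def σ01 : Equiv.Perm (Fin 3) := Equiv.ofBijective ![1, 0, 2] (by decide)
/-- The transposition `(0 2)` of `Fin 3`. [folklore] -/
def σ02 : Equiv.Perm (Fin 3) := Equiv.ofBijective ![2, 1, 0] (by decide)

/-- Scaled distances under `swapY`: parameters `(p,q,s) ↔ (q,p,s)`. [folklore] -/
theorem dv3_swapY (y : Y) (j : Fin 3) : dv3 p q s (swapY y) j = dv3 q p s y (σ01 j) := by
  fin_cases j <;> simp [swapY, dv3, σ01, dist_comm]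

/-- Scaled distances under `shearY`: parameters `(p,q,s) ↔ (s,q,p)`. [folklore] -/
theorem dv3_shearY (y : Y) (j : Fin 3) : dv3 p q s (shearY y) j = dv3 s q p y (σ02 j) := by
  have h1 : ∀ a b : E2, ‖a + -b‖ = dist a b := fun a b => by rw [dist_eq_norm, ← sub_eq_add_neg]
  have h2 : ∀ a b : E2, dist (a + -b) (-b) = ‖a‖ := fun a b => by
    rw [dist_eq_norm]; congr 1; abel
  fin_cases j <;> simp [shearY, dv3, σ02, h1, h2]

/-- `swapY` preserves volume. [folklore] -/
theorem measurePreserving_swapY : MeasurePreserving swapY (volume : Measure Y) volume :=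
  Measure.measurePreserving_swap (μ := (volume : Measure E2)) (ν := (volume : Measure E2))

/-- `shearY` preserves volume. [folklore] -/
theorem measurePreserving_shearY : MeasurePreserving shearY (volume : Measure Y) volume := by
  have h1 : MeasurePreserving (fun y : Y => (y.1, -y.2)) (volume : Measure Y) volume :=
    (MeasurePreserving.id (volume : Measure E2)).prod (Measure.measurePreserving_neg volume)
  have h2 : MeasurePreserving (fun y : Y => (y.1 + y.2, y.2)) (volume : Measure Y) volume :=
    measurePreserving_add_prod (volume : Measure E2) (volume : Measure E2)
  exact h2.comp h1

/-- `vol(piece3 p q s 1) = vol(piece3 q p s 0)`. [folklore] -/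
theorem volume_piece3_1 : volume (piece3 p q s 1) = volume (piece3 q p s 0) := by
  have h := preimage_piece3 (σ := σ01) (dv3_swapY (p := p) (q := q) (s := s)) 1
  have e : σ01 1 = 0 := by simp [σ01]
  rw [e] at h
  rw [← h, measurePreserving_swapY.measure_preimage (measurableSet_piece3 p q s 1).nullMeasurableSet]

/-- `vol(piece3 p q s 2) = vol(piece3 s q p 0)`. [folklore] -/
theorem volume_piece3_2 : volume (piece3 p q s 2) = volume (piece3 s q p 0) := by
  have h := preimage_piece3 (σ := σ02) (dv3_shearY (p := p) (q := q) (s := s)) 2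
  have e : σ02 2 = 0 := by simp [σ02]
  rw [e] at h
  rw [← h, measurePreserving_shearY.measure_preimage (measurableSet_piece3 p q s 2).nullMeasurableSet]


/-! the piece where `‖x‖/p` is maximal -/

/-- The planar lens with radii `a` (centre `0`) and `b` (centre `d·ex`). [folklore] -/
def lens2 (a b d : ℝ) : Set E2 := ball (0 : E2) a ∩ ball (d • ex) b

/-- `lens2` is measurable. [folklore] -/
theorem measurableSet_lens2 (a b d : ℝ) : MeasurableSet (lens2 a b d) :=
  measurableSet_ball.inter measurableSet_ball

variable (p q s) in
/-- Section of `piece3 p q s 0` over `x`. [folklore] -/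
def sect0 (x : E2) : Set E2 := {x' | ‖x'‖ / q < ‖x‖ / p ∧ dist x x' / s < ‖x‖ / p}

/-- `piece3 0` through its sections. [folklore] -/
theorem piece3_zero_eq (hp : 0 < p) :
    piece3 p q s 0 = {y : Y | ‖y.1‖ < p ∧ y.2 ∈ sect0 p q s y.1} := by
  ext ⟨x, x'⟩
  simp only [piece3, mem_setOf_eq, sect0]
  constructor
  · rintro ⟨h1, h2⟩
    refine ⟨?_, ?_, ?_⟩
    · have := h1 0; simp only [dv3_0] at this; rwa [div_lt_one hp] at this
    · simpa using h2 1 (by decide)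
    · simpa using h2 2 (by decide)
  · rintro ⟨h0, h1, h2⟩
    have h0' : ‖x‖ / p < 1 := by rwa [div_lt_one hp]
    refine ⟨fun j => ?_, fun j hj => ?_⟩
    · fin_cases j <;> simp <;> linarith
    · fin_cases j <;> simp at hj ⊢ <;> assumption

/-- **Scaling**: the section over `x ≠ 0` is `(‖x‖/p) •` a lens of radii `q`, `s` at centre distance `p`. [folklore] -/
theorem sect0_eq_smul (hp : 0 < p) (hq : 0 < q) (hs : 0 < s) {x : E2} (hx : x ≠ 0) :
    sect0 p q s x = (‖x‖ / p) • (ball (0 : E2) q ∩ ball ((‖x‖ / p)⁻¹ • x) s) := by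
  have hr : 0 < ‖x‖ / p := div_pos (norm_pos_iff.mpr hx) hp
  ext x'
  rw [Set.mem_smul_set_iff_inv_smul_mem₀ hr.ne']
  simp only [sect0, mem_setOf_eq, mem_inter_iff, mem_ball, dist_zero_right, norm_smul, norm_inv,
    Real.norm_of_nonneg hr.le]
  rw [dist_smul₀, norm_inv, Real.norm_of_nonneg hr.le, dist_comm x' x,
    inv_mul_lt_iff₀ hr, inv_mul_lt_iff₀ hr, div_lt_iff₀ hq, div_lt_iff₀ hs]


/-- `dim E2 = 2`. [folklore] -/
theorem finrank_E2 : Module.finrank ℝ E2 = 2 := finrank_euclideanSpace_fin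

/-- **Rotation invariance** of the planar lens area (Householder reflection). [folklore] -/
theorem volume_ball_inter_ball_eq {c : E2} {d : ℝ} (hc : ‖c‖ = d) (a b : ℝ) :
    volume (ball (0 : E2) a ∩ ball c b) = volume (lens2 a b d) := by
  have hw : ‖c‖ = ‖d • ex‖ := by
    rw [norm_smul, norm_ex, mul_one, Real.norm_of_nonneg (hc ▸ norm_nonneg c), hc]
  have hR := Submodule.reflection_sub hw
  set R := (ℝ ∙ (c - d • ex))ᗮ.reflection with hRdef
  have hset : ball (0 : E2) a ∩ ball c b = R ⁻¹' (lens2 a b d) := by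
    rw [lens2, preimage_inter, LinearIsometryEquiv.preimage_ball, LinearIsometryEquiv.preimage_ball,
      map_zero, ← hR, LinearIsometryEquiv.symm_apply_apply]
  rw [hset, R.measurePreserving.measure_preimage (measurableSet_lens2 a b d).nullMeasurableSet]

/-- `vol(sect0 x) = (‖x‖/p)² · area(lens2 q s p)`. [folklore] -/
theorem volume_sect0 (hp : 0 < p) (hq : 0 < q) (hs : 0 < s) (x : E2) :
    volume (sect0 p q s x) = ENNReal.ofReal ((‖x‖ / p) ^ 2) * volume (lens2 q s p) := by
  by_cases hx : x = 0
  · subst hx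
    have : sect0 p q s (0 : E2) = ∅ := by
      ext x'
      simp only [sect0, norm_zero, zero_div, mem_setOf_eq, mem_empty_iff_false, iff_false, not_and]
      intro h; exact absurd h (not_lt.mpr (div_nonneg (norm_nonneg _) hq.le))
    rw [this, measure_empty, norm_zero, zero_div]
    simp
  · have hr : 0 < ‖x‖ / p := div_pos (norm_pos_iff.mpr hx) hp
    rw [sect0_eq_smul hp hq hs hx, Measure.addHaar_smul_of_nonneg volume hr.le, finrank_E2,
      volume_ball_inter_ball_eq]
    rw [norm_smul, norm_inv, Real.norm_of_nonneg hr.le]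
    field_simp

/-- `area D(0,1) = π` as a real number. [folklore] -/
theorem volume_real_unitBall2 : (volume : Measure E2).real (ball 0 1) = π := by
  rw [measureReal_def, EuclideanSpace.volume_ball_fin_two]
  rw [ENNReal.toReal_mul, ← ENNReal.ofReal_pow zero_le_one, ENNReal.toReal_ofReal (by positivity),
    ENNReal.toReal_ofReal (by positivity)]
  ring

/-- **Radial integration in the plane**: `∫ h(‖x‖) dx = 2π ∫₀^∞ y h(y) dy`. [folklore] -/
theorem integral_norm_E2 (h : ℝ → ℝ) :
    ∫ x : E2, h ‖x‖ = 2 * π * ∫ y in Ioi (0 : ℝ), y * h y := by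
  rw [integral_fun_norm_addHaar volume h, finrank_E2, volume_real_unitBall2]
  simp only [nsmul_eq_mul, smul_eq_mul, Nat.cast_ofNat]
  have : (2 : ℕ) - 1 = 1 := rfl
  simp only [this, pow_one]
  ring

/-- `∫_{‖x‖<p} (‖x‖/p)² dx = π p²/2`. [folklore] -/
theorem lintegral_ball_norm_sq (hp : 0 < p) :
    ∫⁻ x : E2, (ball (0 : E2) p).indicator (fun x => ENNReal.ofReal ((‖x‖ / p) ^ 2)) x =
      ENNReal.ofReal (π * p ^ 2 / 2) := by
  have h1 : ∀ x : E2, (ball (0 : E2) p).indicator (fun x => ENNReal.ofReal ((‖x‖ / p) ^ 2)) x =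
      ENNReal.ofReal ((fun y => (Iio p).indicator (fun y => (y / p) ^ 2) y) ‖x‖) := by
    intro x
    by_cases hx : x ∈ ball (0 : E2) p
    · have hx' : ‖x‖ ∈ Iio p := by simpa using hx
      simp only [indicator_of_mem hx, indicator_of_mem hx']
    · have hx' : ‖x‖ ∉ Iio p := by simpa using hx
      simp only [indicator_of_notMem hx, indicator_of_notMem hx', ENNReal.ofReal_zero]
  simp_rw [h1]
  have hint : Integrable fun x : E2 => (fun y => (Iio p).indicator (fun y => (y / p) ^ 2) y) ‖x‖ := by
    have : (fun x : E2 => (fun y => (Iio p).indicator (fun y => (y / p) ^ 2) y) ‖x‖) =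
        (ball (0 : E2) p).indicator fun x => (‖x‖ / p) ^ 2 := by
      ext x
      by_cases hx : x ∈ ball (0 : E2) p
      · have hx' : ‖x‖ ∈ Iio p := by simpa using hx
        simp only [indicator_of_mem hx, indicator_of_mem hx']
      · have hx' : ‖x‖ ∉ Iio p := by simpa using hx
        simp only [indicator_of_notMem hx, indicator_of_notMem hx']
    rw [this, integrable_indicator_iff measurableSet_ball]
    exact ((by fun_prop : Continuous fun x : E2 => (‖x‖ / p) ^ 2).continuousOn.integrableOn_compact
      (isCompact_closedBall (0 : E2) p)).mono_set ball_subset_closedBall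
  rw [← ofReal_integral_eq_lintegral_ofReal hint (ae_of_all _ fun x => ?_)]
  swap
  · simp only
    by_cases hx : ‖x‖ ∈ Iio p
    · simp only [indicator_of_mem hx]; positivity
    · simp only [indicator_of_notMem hx]; exact le_rfl
  congr 1
  rw [integral_norm_E2]
  have h2 : ∀ y : ℝ, y * (Iio p).indicator (fun y => (y / p) ^ 2) y =
      (Iio p).indicator (fun y => p⁻¹ ^ 2 * y ^ 3) y := by
    intro y
    by_cases hy : y ∈ Iio p
    · simp only [indicator_of_mem hy]; field_simp
    · simp only [indicator_of_notMem hy, mul_zero]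
  simp_rw [h2]
  rw [setIntegral_indicator measurableSet_Iio, Ioi_inter_Iio, ← integral_Ioc_eq_integral_Ioo,
    ← intervalIntegral.integral_of_le hp.le, intervalIntegral.integral_const_mul, integral_pow]
  field_simp
  norm_num
  ring

/-- **The first piece**: `vol(piece3 p q s 0) = (π p²/2) · area(lens2 q s p)`. [folklore] -/
theorem volume_piece3_zero (hp : 0 < p) (hq : 0 < q) (hs : 0 < s) :
    volume (piece3 p q s 0) = ENNReal.ofReal (π * p ^ 2 / 2) * volume (lens2 q s p) := by
  have hmeas := measurableSet_piece3 p q s 0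
  have hfin : volume (lens2 q s p) ≠ ⊤ :=
    measure_ne_top_of_subset inter_subset_left measure_ball_lt_top.ne
  rw [Measure.volume_eq_prod, Measure.prod_apply hmeas, ← lintegral_ball_norm_sq hp,
    ← lintegral_mul_const' _ _ hfin]
  congr 1
  ext x
  have : Prod.mk x ⁻¹' piece3 p q s 0 = if ‖x‖ < p then sect0 p q s x else ∅ := by
    rw [piece3_zero_eq hp]
    ext x'
    split_ifs with h <;> simp [h]
  rw [this]
  by_cases hx : ‖x‖ < p
  · rw [if_pos hx, indicator_of_mem (mem_ball_zero_iff.mpr hx), volume_sect0 hp hq hs]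
  · rw [if_neg hx, indicator_of_notMem (fun h => hx (mem_ball_zero_iff.mp h)), measure_empty, zero_mul]

/-- **Disc-pair measure through three lens areas** (homogeneity of degree `4` in `(p,q,s)`, realised by the partition + scaling): `vol(DPE p q s) = (πp²/2)·area(lens2 q s p) + (πq²/2)·area(lens2 p s q) + (πs²/2)·area(lens2 q p s)`. [folklore] -/
theorem volume_DPE (hp : 0 < p) (hq : 0 < q) (hs : 0 < s) :
    volume (DPE p q s) = ENNReal.ofReal (π * p ^ 2 / 2) * volume (lens2 q s p) +
      ENNReal.ofReal (π * q ^ 2 / 2) * volume (lens2 p s q) +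
      ENNReal.ofReal (π * s ^ 2 / 2) * volume (lens2 q p s) := by
  rw [volume_DPE_eq_sum hp hq hs, volume_piece3_1, volume_piece3_2, volume_piece3_zero hp hq hs,
    volume_piece3_zero hq hp hs, volume_piece3_zero hs hq hp]



/-! ### closed forms for the disc-pair measure -/


/-- The planar lens area is positive in the triangle case. [folklore] -/
theorem lensArea_pos {a b d : ℝ} (ha : 0 < a) (hb : 0 < b) (hd : 0 < d) (h1 : d < a + b)
    (h2 : a < d + b) (h3 : b < d + a) : 0 < lensArea a b d := by
  have hvol := volume_lens2 ha hb hd h1 h2 h3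
  have hne : (ball (0 : E2) a ∩ ball (d • ex) b).Nonempty := by
    refine ⟨(t0 a b d) • ex, ?_, ?_⟩
    · rw [mem_ball_zero_iff, norm_smul, norm_ex, mul_one, Real.norm_eq_abs, abs_lt]
      constructor
      · simp only [t0]; rw [lt_div_iff₀ (by linarith)]; nlinarith
      · simp only [t0]; rw [div_lt_iff₀ (by linarith)]; nlinarith
    · rw [mem_ball, dist_eq_norm, ← sub_smul, norm_smul, norm_ex, mul_one, Real.norm_eq_abs, abs_lt]
      constructor
      · simp only [t0]; rw [lt_sub_iff_add_lt, lt_div_iff₀ (by linarith)]; nlinarith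
      · simp only [t0]; rw [sub_lt_iff_lt_add, div_lt_iff₀ (by linarith)]; nlinarith
  have hpos : 0 < volume (ball (0 : E2) a ∩ ball (d • ex) b) :=
    (isOpen_ball.inter isOpen_ball).measure_pos volume hne
  rw [hvol, ENNReal.ofReal_pos] at hpos
  exact hpos

/-- **Closed form of the disc-pair measure in the triangle case**: `(πp²/2)·lensArea q s p + (πq²/2)·lensArea p s q + (πs²/2)·lensArea q p s` (`= π(q²s²A_p + p²s²A_q + p²q²A_s) − (π/4)(p²+q²+s²)√H`, the `n = 1` case of Lyberg 2005 §3 via Sonine–Dougall). [folklore] -/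
def Mtri (p q s : ℝ) : ℝ :=
  π * p ^ 2 / 2 * lensArea q s p + π * q ^ 2 / 2 * lensArea p s q + π * s ^ 2 / 2 * lensArea q p s

/-- `vol(DPE p q s) = Mtri p q s` in the triangle case. [folklore] -/
theorem volume_DPE_tri (hp : 0 < p) (hq : 0 < q) (hs : 0 < s) (h1 : s < p + q) (h2 : p < q + s)
    (h3 : q < p + s) : volume (DPE p q s) = ENNReal.ofReal (Mtri p q s) := by
  rw [volume_DPE hp hq hs, lens2, lens2, lens2,
    volume_lens2 hq hs hp (by linarith) (by linarith) (by linarith),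
    volume_lens2 hp hs hq (by linarith) (by linarith) (by linarith),
    volume_lens2 hq hp hs (by linarith) (by linarith) (by linarith)]
  have l1 := (lensArea_pos hq hs hp (by linarith) (by linarith) (by linarith)).le
  have l2 := (lensArea_pos hp hs hq (by linarith) (by linarith) (by linarith)).le
  have l3 := (lensArea_pos hq hp hs (by linarith) (by linarith) (by linarith)).le
  rw [← ENNReal.ofReal_mul (by positivity), ← ENNReal.ofReal_mul (by positivity),
    ← ENNReal.ofReal_mul (by positivity), ← ENNReal.ofReal_add (by positivity) (by positivity),
    ← ENNReal.ofReal_add (by positivity) (by positivity), Mtri]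

/-- `Mtri ≥ 0` in the triangle case. [folklore] -/
theorem Mtri_nonneg (hp : 0 < p) (hq : 0 < q) (hs : 0 < s) (h1 : s < p + q) (h2 : p < q + s)
    (h3 : q < p + s) : 0 ≤ Mtri p q s := by
  have l1 := (lensArea_pos hq hs hp (by linarith) (by linarith) (by linarith)).le
  have l2 := (lensArea_pos hp hs hq (by linarith) (by linarith) (by linarith)).le
  have l3 := (lensArea_pos hq hp hs (by linarith) (by linarith) (by linarith)).le
  simp only [Mtri]; positivity

/-- The cap case `s ≥ p + q`: `vol(DPE p q s) = π² p² q²`. [folklore] -/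
theorem volume_DPE_cap (hp : 0 < p) (hq : 0 < q) (h : p + q ≤ s) :
    volume (DPE p q s) = ENNReal.ofReal (π ^ 2 * p ^ 2 * q ^ 2) := by
  have hs : 0 < s := by linarith
  have : DPE p q s = ball (0 : E2) p ×ˢ ball (0 : E2) q := by
    ext ⟨x, x'⟩
    simp only [DPE, mem_setOf_eq, mem_prod, mem_ball_zero_iff]
    constructor
    · intro hj
      have h0 := hj 0; have h1 := hj 1
      simp only [dv3_0, dv3_1, div_lt_one hp, div_lt_one hq] at h0 h1
      exact ⟨h0, h1⟩
    · rintro ⟨h0, h1⟩ j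
      fin_cases j
      · simpa [div_lt_one hp] using h0
      · simpa [div_lt_one hq] using h1
      · show dist x x' / s < 1
        rw [div_lt_one hs]
        calc dist x x' ≤ ‖x‖ + ‖x'‖ := by
              rw [dist_eq_norm]; exact norm_sub_le x x'
          _ < p + q := add_lt_add h0 h1
          _ ≤ s := h
  rw [this, Measure.volume_eq_prod, Measure.prod_prod, EuclideanSpace.volume_ball_fin_two,
    EuclideanSpace.volume_ball_fin_two, ← ENNReal.ofReal_pow hp.le, ← ENNReal.ofReal_pow hq.le,
    ← ENNReal.ofReal_mul (by positivity), ← ENNReal.ofReal_mul (by positivity),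
    ← ENNReal.ofReal_mul (by positivity)]
  congr 1; ring

/-- `DP` is empty when a squared radius is `≤ 0`. [folklore] -/
theorem DP_empty_of_nonpos {r₁ r₂ r₃ : ℝ} (h : r₁ ≤ 0 ∨ r₂ ≤ 0 ∨ r₃ ≤ 0) : DP r₁ r₂ r₃ = ∅ := by
  ext w
  simp only [DP, mem_setOf_eq, mem_empty_iff_false, iff_false, not_and]
  intro h1 h2 h3
  rcases h with h | h | h <;> nlinarith [sq_nonneg (w.1 0), sq_nonneg (w.1 1), sq_nonneg (w.2 0),
    sq_nonneg (w.2 1), sq_nonneg (w.1 0 - w.2 0), sq_nonneg (w.1 1 - w.2 1)]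

/-- `‖toLp x‖ < √r` in coordinates. [folklore] -/
theorem norm_toLp_lt_iff (x : F2) {r : ℝ} (_hr : 0 < r) :
    ‖(WithLp.toLp 2 x : E2)‖ < Real.sqrt r ↔ x 0 ^ 2 + x 1 ^ 2 < r := by
  rw [EuclideanSpace.norm_eq, Real.sqrt_lt_sqrt_iff (by positivity)]
  simp [Fin.sum_univ_two]

/-- `dist (toLp x) (toLp x′) < √r` in coordinates. [folklore] -/
theorem dist_toLp_lt_iff (x x' : F2) {r : ℝ} (_hr : 0 < r) :
    dist (WithLp.toLp 2 x : E2) (WithLp.toLp 2 x') < Real.sqrt r ↔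
      (x 0 - x' 0) ^ 2 + (x 1 - x' 1) ^ 2 < r := by
  rw [EuclideanSpace.dist_eq, Real.sqrt_lt_sqrt_iff (by positivity)]
  simp [Fin.sum_univ_two, Real.dist_eq, sq_abs]

/-- `vol(DP r₁ r₂ r₃) = vol(DPE √r₁ √r₂ √r₃)` for positive squared radii. [folklore] -/
theorem volume_DP_eq {r₁ r₂ r₃ : ℝ} (h1 : 0 < r₁) (h2 : 0 < r₂) (h3 : 0 < r₃) :
    volume (DP r₁ r₂ r₃) = volume (DPE (Real.sqrt r₁) (Real.sqrt r₂) (Real.sqrt r₃)) := by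
  have hmp : MeasurePreserving (fun w : F2 × F2 => ((WithLp.toLp 2 w.1 : E2), (WithLp.toLp 2 w.2 : E2)))
      volume volume :=
    (PiLp.volume_preserving_toLp (Fin 2)).prod (PiLp.volume_preserving_toLp (Fin 2))
  have hset : DP r₁ r₂ r₃ = (fun w : F2 × F2 => ((WithLp.toLp 2 w.1 : E2), (WithLp.toLp 2 w.2 : E2))) ⁻¹'
      DPE (Real.sqrt r₁) (Real.sqrt r₂) (Real.sqrt r₃) := by
    ext w
    simp only [DP, mem_setOf_eq, mem_preimage, DPE]
    constructor
    · rintro ⟨ha, hb, hc⟩ j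
      fin_cases j
      · simpa [div_lt_one (Real.sqrt_pos.mpr h1), norm_toLp_lt_iff _ h1] using ha
      · simpa [div_lt_one (Real.sqrt_pos.mpr h2), norm_toLp_lt_iff _ h2] using hb
      · simpa [div_lt_one (Real.sqrt_pos.mpr h3), dist_toLp_lt_iff _ _ h3] using hc
    · intro hj
      have ha := hj 0; have hb := hj 1; have hc := hj 2
      simp only [dv3_0, dv3_1, dv3_2, div_lt_one (Real.sqrt_pos.mpr h1),
        div_lt_one (Real.sqrt_pos.mpr h2), div_lt_one (Real.sqrt_pos.mpr h3),
        norm_toLp_lt_iff _ h1, norm_toLp_lt_iff _ h2, dist_toLp_lt_iff _ _ h3] at ha hb hc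
      exact ⟨ha, hb, hc⟩
  rw [hset, hmp.measure_preimage (measurableSet_DPE _ _ _).nullMeasurableSet]




/-- Joint measurability of the family `DP`. [folklore] -/
theorem measurableSet_DP_family :
    MeasurableSet {x : (ℝ × ℝ × ℝ) × (F2 × F2) | x.2 ∈ DP x.1.1 x.1.2.1 x.1.2.2} := by
  have : {x : (ℝ × ℝ × ℝ) × (F2 × F2) | x.2 ∈ DP x.1.1 x.1.2.1 x.1.2.2} =
      {x | x.2.1 0 ^ 2 + x.2.1 1 ^ 2 < x.1.1} ∩ {x | x.2.2 0 ^ 2 + x.2.2 1 ^ 2 < x.1.2.1} ∩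
      {x | (x.2.1 0 - x.2.2 0) ^ 2 + (x.2.1 1 - x.2.2 1) ^ 2 < x.1.2.2} := by
    ext x; simp only [DP, mem_setOf_eq, mem_inter_iff]; tauto
  rw [this]
  exact ((measurableSet_lt (by fun_prop) (by fun_prop)).inter
    (measurableSet_lt (by fun_prop) (by fun_prop))).inter (measurableSet_lt (by fun_prop) (by fun_prop))

/-- `(r₁,r₂,r₃) ↦ vol(DP r₁ r₂ r₃)` is measurable. [folklore] -/
theorem measurable_volume_DP : Measurable fun r : ℝ × ℝ × ℝ => volume (DP r.1 r.2.1 r.2.2) :=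
  measurable_measure_prodMk_left (ν := (volume : Measure (F2 × F2))) measurableSet_DP_family

/-- `msq (1 − z) = msq z`. [folklore] -/
theorem msq_symm (z : ℝ) : msq (1 - z) = msq z := by
  simp only [msq, sub_sub_cancel, min_comm]

/-- `msq z = 1 − z²` for `z ≥ 1/2`. [folklore] -/
theorem msq_of_half_le {z : ℝ} (hz : 1 / 2 ≤ z) : msq z = 1 - z ^ 2 := by
  simp only [msq]; apply min_eq_left; nlinarith

/-- `msq z ≤ 0` off `(0,1)`. [folklore] -/
theorem msq_nonpos {z : ℝ} (hz : z ∉ Ioo (0 : ℝ) 1) : msq z ≤ 0 := by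
  simp only [mem_Ioo, not_and_or, not_lt] at hz
  simp only [msq]
  rcases hz with hz | hz
  · exact le_trans (min_le_right _ _) (by nlinarith)
  · exact le_trans (min_le_left _ _) (by nlinarith)

/-- The integrand of the cylindrical reduction, `vol(DP(msq z, msq z′, 1 − (z−z′)²))`. [folklore] -/
def Gf (zz : ℝ × ℝ) : ℝ≥0∞ := volume (DP (msq zz.1) (msq zz.2) (1 - (zz.1 - zz.2) ^ 2))

/-- `Gf` is measurable. [folklore] -/
theorem measurable_Gf : Measurable Gf := by
  have hm : Measurable msq := by unfold msq; fun_prop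
  exact measurable_volume_DP.comp (by fun_prop : Measurable fun zz : ℝ × ℝ =>
    (msq zz.1, msq zz.2, 1 - (zz.1 - zz.2) ^ 2))

/-- `Gf` vanishes off `(0,1)²`. [folklore] -/
theorem Gf_eq_zero {zz : ℝ × ℝ} (h : zz ∉ Ioo (0 : ℝ) 1 ×ˢ Ioo (0 : ℝ) 1) : Gf zz = 0 := by
  simp only [mem_prod, not_and_or] at h
  simp only [Gf]
  rcases h with h | h
  · rw [DP_empty_of_nonpos (Or.inl (msq_nonpos h)), measure_empty]
  · rw [DP_empty_of_nonpos (Or.inr (Or.inl (msq_nonpos h))), measure_empty]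

/-- `Gf` is invariant under `(z,z′) ↦ (1−z, 1−z′)`. [folklore] -/
theorem Gf_symm (zz : ℝ × ℝ) : Gf (1 - zz.1, 1 - zz.2) = Gf zz := by
  simp only [Gf, msq_symm]
  congr 2; ring

/-- SAME-SIDE integrand on `[1/2,1]²`: `vol(DP(1−u², 1−v², 1−(u−v)²))`. [folklore] -/
def Gs (w : ℝ × ℝ) : ℝ≥0∞ := volume (DP (1 - w.1 ^ 2) (1 - w.2 ^ 2) (1 - (w.1 - w.2) ^ 2))
/-- OPPOSITE-SIDE integrand on `[1/2,1]²`: `vol(DP(1−u², 1−v², 1−(u+v−1)²))`. [folklore] -/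
def Go (w : ℝ × ℝ) : ℝ≥0∞ := volume (DP (1 - w.1 ^ 2) (1 - w.2 ^ 2) (1 - (w.1 + w.2 - 1) ^ 2))

/-- `Gf = Gs` on `[1/2,1]²`. [folklore] -/
theorem Gf_eq_Gs {w : ℝ × ℝ} (h1 : 1 / 2 ≤ w.1) (h2 : 1 / 2 ≤ w.2) : Gf w = Gs w := by
  simp only [Gf, Gs, msq_of_half_le h1, msq_of_half_le h2]

/-- `Gf(u, 1−v) = Go(u,v)` on `[1/2,1]²`. [folklore] -/
theorem Gf_eq_Go {w : ℝ × ℝ} (h1 : 1 / 2 ≤ w.1) (h2 : 1 / 2 ≤ w.2) : Gf (w.1, 1 - w.2) = Go w := by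
  simp only [Gf, Go, msq_symm, msq_of_half_le h1, msq_of_half_le h2]
  congr 2; ring

/-- The square `[1/2,1]²`. [folklore] -/
def Sq : Set (ℝ × ℝ) := Icc (1 / 2) 1 ×ˢ Icc (1 / 2) 1

/-- `Sq` is measurable. [folklore] -/
theorem measurableSet_Sq : MeasurableSet Sq := measurableSet_Icc.prod measurableSet_Icc

/-- `(z,z′) ↦ (1−z, z′)` preserves area. [folklore] -/
theorem measurePreserving_reflect_fst :
    MeasurePreserving (fun zz : ℝ × ℝ => (1 - zz.1, zz.2)) volume volume := by
  have h1 : MeasurePreserving (fun z : ℝ => 1 - z) volume volume :=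
    Measure.measurePreserving_sub_left volume (1 : ℝ)
  exact h1.prod (MeasurePreserving.id volume)

/-- `(z,z′) ↦ (z, 1−z′)` preserves area. [folklore] -/
theorem measurePreserving_reflect_snd :
    MeasurePreserving (fun zz : ℝ × ℝ => (zz.1, 1 - zz.2)) volume volume := by
  have h1 : MeasurePreserving (fun z : ℝ => 1 - z) volume volume :=
    Measure.measurePreserving_sub_left volume (1 : ℝ)
  exact (MeasurePreserving.id volume).prod h1

/-- `(z,z′) ↦ (1−z, 1−z′)` preserves area. [folklore] -/
theorem measurePreserving_reflect_both :
    MeasurePreserving (fun zz : ℝ × ℝ => (1 - zz.1, 1 - zz.2)) volume volume :=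
  measurePreserving_reflect_snd.comp measurePreserving_reflect_fst

/-- `Gs` is measurable. [folklore] -/
theorem measurable_Gs : Measurable Gs :=
  measurable_volume_DP.comp (by fun_prop : Measurable fun w : ℝ × ℝ =>
    (1 - w.1 ^ 2, 1 - w.2 ^ 2, 1 - (w.1 - w.2) ^ 2))

/-- `Go` is measurable. [folklore] -/
theorem measurable_Go : Measurable Go :=
  measurable_volume_DP.comp (by fun_prop : Measurable fun w : ℝ × ℝ =>
    (1 - w.1 ^ 2, 1 - w.2 ^ 2, 1 - (w.1 + w.2 - 1) ^ 2))

/-- A set squeezed between the open and the closed square is a.e. the closed square. [folklore] -/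
theorem ae_eq_Sq {s : Set (ℝ × ℝ)} (h1 : Ioo (1/2 : ℝ) 1 ×ˢ Ioo (1/2 : ℝ) 1 ⊆ s) (h2 : s ⊆ Sq) :
    s =ᵐ[volume] Sq := by
  have hnull : volume (Sq \ Ioo (1/2 : ℝ) 1 ×ˢ Ioo (1/2 : ℝ) 1) = 0 := by
    have hsub : Sq \ Ioo (1/2 : ℝ) 1 ×ˢ Ioo (1/2 : ℝ) 1 ⊆
        ({1/2, 1} : Set ℝ) ×ˢ (univ : Set ℝ) ∪ (univ : Set ℝ) ×ˢ ({1/2, 1} : Set ℝ) := by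
      intro zz hzz
      simp only [Sq, mem_sdiff, mem_prod, mem_Icc, mem_Ioo, not_and_or, not_lt] at hzz
      obtain ⟨⟨⟨ha1, ha2⟩, ⟨hb1, hb2⟩⟩, h⟩ := hzz
      simp only [mem_union, mem_prod, mem_insert_iff, mem_singleton_iff, mem_univ, and_true, true_and]
      rcases h with (h | h) | (h | h)
      · left; left; linarith
      · left; right; linarith
      · right; left; linarith
      · right; right; linarith
    have hfin : volume ({1/2, 1} : Set ℝ) = 0 := Set.Finite.measure_zero (toFinite _) volume
    apply measure_mono_null hsub
    apply measure_union_null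
    · rw [Measure.volume_eq_prod, Measure.prod_prod, hfin, zero_mul]
    · rw [Measure.volume_eq_prod, Measure.prod_prod, hfin, mul_zero]
  refine (ae_eq_set).mpr ⟨?_, ?_⟩
  · rw [sdiff_eq_empty.mpr h2, measure_empty]
  · exact measure_mono_null (sdiff_subset_sdiff_right h1) hnull

/-- **Folding the `(z,z′)` square onto `[1/2,1]²`** (`u = max(z,1−z)`): `∫ Gf = 2 ∫_{[1/2,1]²} (Gs + Go)` (Lyberg 2005 §3: the same-side `α(z,−z′)` and opposite-side `α(z,z′)` terms at `r = 1`). [folklore] -/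
theorem lintegral_Gf_fold : ∫⁻ zz, Gf zz = 2 * ∫⁻ w in Sq, (Gs w + Go w) := by
  -- restrict to (0,1]²
  have hsupp : ∫⁻ zz, Gf zz = ∫⁻ zz in Ioc (0:ℝ) 1 ×ˢ Ioc (0:ℝ) 1, Gf zz := by
    rw [← lintegral_indicator (measurableSet_Ioc.prod measurableSet_Ioc)]
    congr 1; ext zz
    by_cases h : zz ∈ Ioc (0:ℝ) 1 ×ˢ Ioc (0:ℝ) 1
    · rw [indicator_of_mem h]
    · rw [indicator_of_notMem h, Gf_eq_zero]
      intro h'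
      exact h ⟨Ioo_subset_Ioc_self h'.1, Ioo_subset_Ioc_self h'.2⟩
  set A := Ioc (0:ℝ) (1/2) with hA
  set B := Ioc (1/2:ℝ) 1 with hB
  set B' := Ico (1/2:ℝ) 1 with hB'
  have hI : Ioc (0:ℝ) 1 = A ∪ B := (Ioc_union_Ioc_eq_Ioc (by norm_num) (by norm_num)).symm
  have hdisj : Disjoint A B := Ioc_disjoint_Ioc_of_le le_rfl
  have mA : MeasurableSet A := measurableSet_Ioc
  have mB : MeasurableSet B := measurableSet_Ioc
  have mB' : MeasurableSet B' := measurableSet_Ico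
  have hd1 : Disjoint (A ×ˢ A ∪ A ×ˢ B) (B ×ˢ A ∪ B ×ˢ B) :=
    Disjoint.union_left
      (Disjoint.union_right (hdisj.set_prod_left _ _) (hdisj.set_prod_left _ _))
      (Disjoint.union_right (hdisj.set_prod_left _ _) (hdisj.set_prod_left _ _))
  have hd2 : Disjoint (A ×ˢ A) (A ×ˢ B) := hdisj.set_prod_right _ _
  have hd3 : Disjoint (B ×ˢ A) (B ×ˢ B) := hdisj.set_prod_right _ _
  rw [hsupp, hI, union_prod, prod_union, prod_union,
    lintegral_union ((mB.prod mA).union (mB.prod mB)) hd1,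
    lintegral_union (mA.prod mB) hd2, lintegral_union (mB.prod mB) hd3]
  -- the four pieces
  have hBB : ∫⁻ zz in B ×ˢ B, Gf zz = ∫⁻ w in Sq, Gs w := by
    rw [setLIntegral_congr (ae_eq_Sq (prod_mono Ioo_subset_Ioc_self Ioo_subset_Ioc_self)
      (prod_mono Ioc_subset_Icc_self Ioc_subset_Icc_self))]
    apply setLIntegral_congr_fun measurableSet_Sq
    intro w hw
    exact Gf_eq_Gs hw.1.1 hw.2.1
  have hAA : ∫⁻ zz in A ×ˢ A, Gf zz = ∫⁻ w in Sq, Gs w := by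
    have hpre : (fun zz : ℝ × ℝ => (1 - zz.1, 1 - zz.2)) ⁻¹' (A ×ˢ A) = B' ×ˢ B' := by
      ext zz
      simp only [hA, hB', mem_preimage, mem_prod, mem_Ioc, mem_Ico]
      constructor <;> rintro ⟨⟨h1, h2⟩, ⟨h3, h4⟩⟩ <;> exact ⟨⟨by linarith, by linarith⟩, ⟨by linarith, by linarith⟩⟩
    rw [← measurePreserving_reflect_both.setLIntegral_comp_preimage (mA.prod mA) measurable_Gf, hpre]
    simp_rw [Gf_symm]
    rw [setLIntegral_congr (ae_eq_Sq (prod_mono Ioo_subset_Ico_self Ioo_subset_Ico_self)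
      (prod_mono Ico_subset_Icc_self Ico_subset_Icc_self))]
    apply setLIntegral_congr_fun measurableSet_Sq
    intro w hw
    exact Gf_eq_Gs hw.1.1 hw.2.1
  have hBA : ∫⁻ zz in B ×ˢ A, Gf zz = ∫⁻ w in Sq, Go w := by
    have hpre : (fun zz : ℝ × ℝ => (zz.1, 1 - zz.2)) ⁻¹' (B ×ˢ A) = B ×ˢ B' := by
      ext zz
      simp only [hA, hB, hB', mem_preimage, mem_prod, mem_Ioc, mem_Ico]
      constructor <;> rintro ⟨⟨h1, h2⟩, ⟨h3, h4⟩⟩ <;> exact ⟨⟨by linarith, by linarith⟩, ⟨by linarith, by linarith⟩⟩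
    rw [← measurePreserving_reflect_snd.setLIntegral_comp_preimage (mB.prod mA) measurable_Gf, hpre]
    rw [setLIntegral_congr (ae_eq_Sq (prod_mono Ioo_subset_Ioc_self Ioo_subset_Ico_self)
      (prod_mono Ioc_subset_Icc_self Ico_subset_Icc_self))]
    apply setLIntegral_congr_fun measurableSet_Sq
    intro w hw
    exact Gf_eq_Go hw.1.1 hw.2.1
  have hAB : ∫⁻ zz in A ×ˢ B, Gf zz = ∫⁻ w in Sq, Go w := by
    have hpre : (fun zz : ℝ × ℝ => (1 - zz.1, zz.2)) ⁻¹' (A ×ˢ B) = B' ×ˢ B := by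
      ext zz
      simp only [hA, hB, hB', mem_preimage, mem_prod, mem_Ioc, mem_Ico]
      constructor <;> rintro ⟨⟨h1, h2⟩, ⟨h3, h4⟩⟩ <;> exact ⟨⟨by linarith, by linarith⟩, ⟨by linarith, by linarith⟩⟩
    rw [← measurePreserving_reflect_fst.setLIntegral_comp_preimage (mA.prod mB) measurable_Gf, hpre]
    have : ∀ zz : ℝ × ℝ, Gf (1 - zz.1, zz.2) = Gf (zz.1, 1 - zz.2) := by
      intro zz
      have := Gf_symm (1 - zz.1, zz.2)
      simp only [sub_sub_cancel] at this
      exact this.symm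
    simp_rw [this]
    rw [setLIntegral_congr (ae_eq_Sq (prod_mono Ioo_subset_Ico_self Ioo_subset_Ioc_self)
      (prod_mono Ico_subset_Icc_self Ioc_subset_Icc_self))]
    apply setLIntegral_congr_fun measurableSet_Sq
    intro w hw
    exact Gf_eq_Go hw.1.1 hw.2.1
  rw [hAA, hAB, hBA, hBB, lintegral_add_left measurable_Gs, two_mul]
  ring


/-! ### to real iterated integrals -/

/-- `vol(DP a b c) ≤ π²` for `a, b ≤ 1`. [folklore] -/
theorem volume_DP_le {a b c : ℝ} (ha : a ≤ 1) (hb : b ≤ 1) :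
    volume (DP a b c) ≤ ENNReal.ofReal (π ^ 2) := by
  have hsub : DP a b c ⊆ {w : F2 | w 0 ^ 2 + w 1 ^ 2 < a} ×ˢ {w : F2 | w 0 ^ 2 + w 1 ^ 2 < b} :=
    fun w hw => ⟨hw.1, hw.2.1⟩
  calc volume (DP a b c) ≤ volume ({w : F2 | w 0 ^ 2 + w 1 ^ 2 < a} ×ˢ {w : F2 | w 0 ^ 2 + w 1 ^ 2 < b}) :=
        measure_mono hsub
    _ = ENNReal.ofReal (π * a) * ENNReal.ofReal (π * b) := by
        rw [Measure.volume_eq_prod, Measure.prod_prod, volume_disc, volume_disc]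
    _ ≤ ENNReal.ofReal π * ENNReal.ofReal π := by
        gcongr <;> nlinarith [pi_pos]
    _ = ENNReal.ofReal (π ^ 2) := by rw [← ENNReal.ofReal_mul pi_pos.le, sq]

/-- Real-valued same-side integrand `gs u v = vol(DP(1−u²,1−v²,1−(u−v)²))`. [folklore] -/
def gs (u v : ℝ) : ℝ := (Gs (u, v)).toReal
/-- Real-valued opposite-side integrand `go u v = vol(DP(1−u²,1−v²,1−(u+v−1)²))`. [folklore] -/
def go (u v : ℝ) : ℝ := (Go (u, v)).toReal

/-- `Gs ≤ π²`. [folklore] -/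
theorem Gs_le (w : ℝ × ℝ) : Gs w ≤ ENNReal.ofReal (π ^ 2) :=
  volume_DP_le (by nlinarith [sq_nonneg w.1]) (by nlinarith [sq_nonneg w.2])
/-- `Go ≤ π²`. [folklore] -/
theorem Go_le (w : ℝ × ℝ) : Go w ≤ ENNReal.ofReal (π ^ 2) :=
  volume_DP_le (by nlinarith [sq_nonneg w.1]) (by nlinarith [sq_nonneg w.2])

/-- `Gs = ofReal gs`. [folklore] -/
theorem Gs_eq (w : ℝ × ℝ) : Gs w = ENNReal.ofReal (gs w.1 w.2) := by
  rw [gs, ENNReal.ofReal_toReal (ne_top_of_le_ne_top ENNReal.ofReal_ne_top (Gs_le w))]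
/-- `Go = ofReal go`. [folklore] -/
theorem Go_eq (w : ℝ × ℝ) : Go w = ENNReal.ofReal (go w.1 w.2) := by
  rw [go, ENNReal.ofReal_toReal (ne_top_of_le_ne_top ENNReal.ofReal_ne_top (Go_le w))]

/-- `gs ≥ 0`. [folklore] -/
theorem gs_nonneg (u v : ℝ) : 0 ≤ gs u v := ENNReal.toReal_nonneg
/-- `go ≥ 0`. [folklore] -/
theorem go_nonneg (u v : ℝ) : 0 ≤ go u v := ENNReal.toReal_nonneg
/-- `gs ≤ π²`. [folklore] -/
theorem gs_le (u v : ℝ) : gs u v ≤ π ^ 2 :=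
  ENNReal.toReal_le_of_le_ofReal (by positivity) (Gs_le (u, v))
/-- `go ≤ π²`. [folklore] -/
theorem go_le (u v : ℝ) : go u v ≤ π ^ 2 :=
  ENNReal.toReal_le_of_le_ofReal (by positivity) (Go_le (u, v))

/-- `gs` is measurable. [folklore] -/
theorem measurable_gs : Measurable fun w : ℝ × ℝ => gs w.1 w.2 :=
  measurable_Gs.ennreal_toReal
/-- `go` is measurable. [folklore] -/
theorem measurable_go : Measurable fun w : ℝ × ℝ => go w.1 w.2 :=
  measurable_Go.ennreal_toReal

/-- `gs + go` is integrable on the square. [folklore] -/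
theorem integrableOn_gsgo : IntegrableOn (fun w : ℝ × ℝ => gs w.1 w.2 + go w.1 w.2) Sq volume := by
  refine Measure.integrableOn_of_bounded (M := π ^ 2 + π ^ 2) ?_ ?_ ?_
  · rw [Sq, Measure.volume_eq_prod, Measure.prod_prod]
    exact ENNReal.mul_ne_top measure_Icc_lt_top.ne measure_Icc_lt_top.ne
  · exact (measurable_gs.add measurable_go).aestronglyMeasurable
  · apply ae_of_all
    intro w
    rw [Real.norm_eq_abs, abs_of_nonneg (add_nonneg (gs_nonneg _ _) (go_nonneg _ _))]
    exact add_le_add (gs_le _ _) (go_le _ _)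

/-- **Real form**: `∫_{[1/2,1]²} (Gs + Go) = ofReal (∫_{1/2}^1 ∫_{1/2}^1 (gs u v + go u v) dv du)`. [folklore] -/
theorem lintegral_Sq_eq :
    ∫⁻ w in Sq, (Gs w + Go w) =
      ENNReal.ofReal (∫ u in (1/2 : ℝ)..1, ∫ v in (1/2 : ℝ)..1, (gs u v + go u v)) := by
  have h1 : ∀ w, Gs w + Go w = ENNReal.ofReal (gs w.1 w.2 + go w.1 w.2) := by
    intro w
    rw [Gs_eq, Go_eq, ENNReal.ofReal_add (gs_nonneg _ _) (go_nonneg _ _)]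
  simp_rw [h1]
  rw [← ofReal_integral_eq_lintegral_ofReal integrableOn_gsgo
    (ae_of_all _ fun w => add_nonneg (gs_nonneg _ _) (go_nonneg _ _))]
  congr 1
  rw [Sq, Measure.volume_eq_prod, setIntegral_prod _ (by rw [← Measure.volume_eq_prod]; exact integrableOn_gsgo),
    integral_of_le (by norm_num : (1/2 : ℝ) ≤ 1), integral_Icc_eq_integral_Ioc]
  apply setIntegral_congr_fun measurableSet_Ioc
  intro u _
  simp only
  rw [integral_of_le (by norm_num : (1/2 : ℝ) ≤ 1), integral_Icc_eq_integral_Ioc]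


/-- **The lens pair as a real double integral**:
`vol(lensPair e0) = 2 · ofReal(∫_{1/2}^1 ∫_{1/2}^1 (gs u v + go u v) dv du)`. [folklore] -/
theorem volume_lensPair_eq_ofReal_integral :
    volume (lensPair e0) =
      2 * ENNReal.ofReal (∫ u in (1/2 : ℝ)..1, ∫ v in (1/2 : ℝ)..1, (gs u v + go u v)) := by
  rw [volume_lensPair_eq_lintegral, ← lintegral_Sq_eq, ← lintegral_Gf_fold]
  rfl

end BoltzmannB4

/-- **The complete star as a real double integral** (Lyberg 2005 §§2–3 combined):
`vol(hardSphereStarFour) = (16π/3) · ∫_{1/2}^1 ∫_{1/2}^1 (gs u v + go u v) dv du`, where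
`gs u v` / `go u v` are the measures of the planar disc-pair sets
`DP(1−u², 1−v², 1−(u∓v)²)` resp. `DP(1−u², 1−v², 1−(u+v−1)²)`, given in closed form by
`BoltzmannB4.volume_DPE_tri` / `volume_DPE_cap`. [cite: Lyberg2005, §3 (reduction of χ(1) to a two-dimensional integral, n = 1)] -/
theorem volume_hardSphereStarFour_eq_integral :
    (volume hardSphereStarFour).toReal =
      16 * π / 3 * ∫ u in (1/2 : ℝ)..1, ∫ v in (1/2 : ℝ)..1,
        (BoltzmannB4.gs u v + BoltzmannB4.go u v) := by
  have hJ : 0 ≤ ∫ u in (1/2 : ℝ)..1, ∫ v in (1/2 : ℝ)..1, (BoltzmannB4.gs u v + BoltzmannB4.go u v) := by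
    apply intervalIntegral.integral_nonneg (by norm_num)
    intro u _
    apply intervalIntegral.integral_nonneg (by norm_num)
    intro v _
    exact add_nonneg (BoltzmannB4.gs_nonneg u v) (BoltzmannB4.go_nonneg u v)
  rw [volume_hardSphereStarFour_eq, BoltzmannB4.volume_lensPair_eq_ofReal_integral,
    show (2 : ENNReal) = ENNReal.ofReal 2 by simp, ← ENNReal.ofReal_mul (by norm_num),
    ← ENNReal.ofReal_mul (by positivity), ENNReal.toReal_ofReal (by positivity)]
  ring

end Literature.MathematicalPhysics.StatisticalMechanics

end
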